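import Literature.MathematicalPhysics.QuantumFieldTheory.Balaban1983to89.B4Thm110ZeroBoxDeriv

/-!
# `Balaban1983to89.B4Thm19ZeroBoxHolder` — B4 «Theorem (Proposition 2.1 of [1])», inequality (1.9) = the HÖLDER
# CLAUSE, PROVED at `A = 0` on RECTANGULAR PARALLELEPIPEDS for ALL scales `k ≥ 1` and ALL `0 ≤ α < 1`:
# `|x − x′|^{−α}|(∂^η_μG_k(□)f)(x′) − (∂^η_μG_k(□)f)(x)| ≤ c₀e^{−δ₀dist({x,x′}, supp f)}‖f‖_∞`,
# `G_k(□) = (−Δ^{η,N}_□ + m² + a_kP_k)^{-1}`, `η = L^{-k}`, by the print's own box route (2.34)/(2.38)–(2.39) + Lemma 2.4 (2.36)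

**Source.** T. Bałaban, *Regularity and Decay of Lattice Green's Functions*, Commun. Math. Phys. **89**, 571–597 (1983)
(bib key `Balaban1983RegularityDecay`, «B4» of the 1983–89 series): p. 572 [PDF 2] (1.2)–(1.6), p. 573 [PDF 3] the
difference derivative `∂^η_μ` and the Theorem with (1.9)–(1.10), p. 577 [PDF 7] the Hölder norm (2.14) and Lemma 2.2
(2.16), p. 582 [PDF 12] (2.34), Lemma 2.4 (2.35)–(2.37) and (2.38), p. 583 [PDF 13] (2.39) and the proof remarks, p. 584
[PDF 14] (journal page = PDF page + 570; renders `b2b-balaban-ref1/pages/1983-cmp89-regularity-decay/1983-cmp89-regularity-decay-p003-x2.png`,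
`-p007`, `-p012`, `-p013-x2.png`, read as images).  A new leaf on top of `B4Thm110ZeroBoxDeriv` (the DERIVATIVE clause
of (1.10) at `A = 0` on boxes, whose weighted functional `wsum`, triple-product estimate `wsum_gCB_le`, one-step base and
printed forms are USED BY NAME), of `B4Thm110ZeroBox` (the VALUE clause: the scale-`j` objects `𝒢_j`, `A_j`, `B_j`,
`C_j`, the recursion `Gfine_succ_sub`, `boxOpR_L_inv_decay`, `dsupp`) and of `B4Green242Bridge.greenBoxQ_holder_decay_236_inv`
(the Hölder half (2.36) of Lemma 2.4, kernel-proved there); it is exactly the item «NOT the Hölder quotient (1.9)/(2.16)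
(α > 0)» of the HONEST SCOPE (iii) of `B4Thm110ZeroBoxDeriv`.  No existing module is touched; nothing of B4 is asserted
as a fact.

## WHAT IS PRINTED (verbatim; `≦` of the print written `≤`)

p. 573: «[Of course ∂^η_μ is a difference derivative defined by (∂^η_μA)(x) = η^{−1}(A(x + ηe_μ) − A(x)).]» […] «for an
arbitrary pair of points x, x′ ∈ ηZ^d, let us denote by Γ_{x,x′} a shortest contour connecting these points.» […]
«**Theorem** (Proposition 2.1 of [1]). For α < 1 there exist positive constants δ₀, c₀, R₀ independent of A, k, Ω and
depending on d, M only, c₀ on α also, such that for e sufficiently small and for an arbitrary function f : Ω → R^N, we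
have
|x − x′|^{−α} |U(A(Γ_{x,x′}))(D^η_{A,μ}G_k(Ω, A)f)(x′) − (D^η_{A,μ}G_k(Ω, A)f)(x)| ≤ c₀ exp(−δ₀ dist({x, x′}, supp f))‖f‖_∞   (1.9)
for x, x′ ∈ Ω, and satisfying the condition dist({x, x′}, Ω^c) ≥ R₀. Similarly
|(D^η_{A,μ}G_k(Ω, A)f)(x)|, |(G_k(Ω, A)(x)| ≤ c₀ exp(−δ₀ dist(x, supp f))‖f‖_∞   (1.10)
for x ∈ Ω, dist(x, Ω^c) ≥ R₀.» […] «For some simple sets Ω, e.g. for rectangular parallelepipeds, the inequalities hold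
without any restrictions on the points x, x′, i.e. for all x, x′ ∈ Ω.»

p. 577: «We will need Hölder norms:
‖f‖_{1,α} = max{sup_x|f(x)|, sup_{x,μ}|(D^η_{A,μ}f)(x)|, sup_{x,x′,μ} |x′ − x|^{−α}|U(A(Γ_{x,x′}))(D^η_{A,μ}f)(x′) − (D^η_{A,μ}f)(x)|},   (2.14)
where the suprema are taken on a domain of the function f.» […] «**Lemma 2.2.** Let a rectangular parallelepiped □ be
a sum of few large blocks (e.g., as in the case of the cubes □_j), and let Ã be a regular vector field configuration
[…], constant in a neighbourhood of the boundary of □. Then for e sufficiently small and α < 1, there exists a constant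
c₁ depending on d, α only, such that ‖G_k(□, Ã)f‖_{1,α} ≤ c₁‖f‖_∞,   (2.16)».

p. 582: «This proof is based on renormalization group equations (2.43) of [1] rescaled to the η-lattice:
G_k(□) = C^{(0),η}(□) + Σ_{j=1}^{k−1} a_j²(L^jη)^{−4}G_j^η(□)Q_j^*C^{(j),L^jη}(□)Q_jG_j^η(□).   (2.34)» […]
«**Lemma 2.4.** There exist positive constants c₀, δ₀, and for α < 1, there exists a constant c₁, such that
|(G_j(□)Q_j^*)(x, y)|, |(∂^{L^{−j}}_μG_j(□)Q_j^*)(x, y)| ≤ c₀e^{−δ₀|x−y|},   (2.35)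
|x − x′|^{−α}|(∂^{L^{−j}}_μG_j(□)Q_j^*)(x, y) − (∂^{L^{−j}}_μG_j(□)Q_j^*)(x′, y)| ≤ c₁e^{−δ₀dist({x,x′},y)},   (2.36)
|C^{(j)}(□; y, y′)| ≤ c₀e^{−δ₀|y−y′|},   (2.37)
for arbitrary non-negative integer j, arbitrary, rectangular parallelepiped □ ⊂ L^{−j}Z^d built of large blocks, and
x, x′ ∈ □, y, y′ ∈ □^{(j)} = □∩Z^d.» […] «Using this lemma we will prove Lemma 2.2 for the propagator G_k(□). Let us
start with the proof of the inequality (2.16). We use (2.34) with j-th term rescaled to the L^{−j}-lattice: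
|x − x′|^{−α}((∂^η_μG_k(□)f)(x) − (∂^η_μG_k(□)f)(x′)) = η^{1−α}|η^{−1}x − η^{−1}x′|^{−α}((∂¹_μC^{(0)}(η^{−1}□)f)(η^{−1}x)
− (∂¹_μC^{(0)}(η^{−1}□)f)(η^{−1}x′)) + Σ_{j=1}^{k−1} a_j² Σ_{y∈(L^jη)^{−1}□^{(j)}} (L^jη)^{1−α}|(L^jη)^{−1}x − (L^jη)^{−1}x′|^{−α}
· ((∂^{L^{−j}}_μG_j((L^jη)^{−1}□)Q_j^*)((L^jη)^{−1}x, y) − (∂^{L^{−j}}_μG_j((L^jη)^{−1}□)Q_j^*)((L^jη)^{−1}x′, y))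
· (C^{(j)}((L^jη)^{−1}□)Q_jG_j((L^jη)^{−1}□)f)(y),  x, x′ ∈ □,   (2.38)  hence Lemma 2.4 implies»

p. 583: «|x − x′|^{−α}|(∂^η_μG_k(□)f)(x) − (∂^η_μG_k(□)f)(x′)| ≤ η^{1−α}4c₀O(1)‖f‖_∞ + Σ_{j=1}^{k−1} a_j²(L^jη)^{1−α}c₁
Σ_{y∈(L^jη)^{−1}□^{(j)}} e^{−δ₀dist({(L^jη)^{−1}x,(L^jη)^{−1}x′},y)}·|(C^{(j)}((L^jη)^{−1}□)Q_jG_j((L^jη)^{−1}□)f)(y)|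
≤ O(1) Σ_{j=0}^{k−1} (L^jη)^{1−α}‖f‖_∞ ≤ c′₁‖f‖_∞,   (2.39)  where the constant c′₁ is built of c₀, c₁, Σ_{x∈Z^d} e^{−δ₀|x|},
Σ_{j=1}^∞ (L^{−j})^{1−α}. We estimate in the same way |(G_k(□)f)(x)|, |(∂^η_μG_k(□)f)(x)|, and we get (2.16).» […]
«*Remark.* Let us mention here that the above method can be used also to prove pointwise estimates of G_k(□), G_k(□, A),
and even G_k(Ω, A), their derivatives and "Hölder-derivatives".»

p. 584: «This part of the argument is valid for an arbitrary rectangular parallelepiped □ built of unit blocks, so the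
inequalities are valid for all such sets.»

## WHAT THIS FILE CERTIFIES (kernel-checked, zero `sorry`, no hypotheses; the lineage is USED BY NAME, not re-proved)

For every dimension `d + 1`, every `L = ℓ + 1 ≥ 2`, every window `a ∈ [a₋, a₊]` (`a₋ > 0`), `m² ∈ [0, m²₊]` and
EVERY Hölder exponent `0 ≤ α < 1` there are `δ₀ > 0`, `c₀ > 0` such that for EVERY scale `k ≥ 1` (`η = L^{-k}`), every
`(a, m²)` in the window, every box `□ = Π_μ[0, M_μ)` with integer sides `M_μ ≥ 1`, every axis `μ` and all sites
`x ≠ x′` of `□ ∩ ηℤ^{d+1}` whose `μ`-neighbours `xe = x + e_μ`, `xe′ = x′ + e_μ` lie in `□` (lattice units;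
`xe.1 = x.1 + Pi.single μ 1`, `xe'.1 = x'.1 + Pi.single μ 1`, `x'.1 ≠ x.1`), the propagator `G = G_k(□) =
(B4BoxCov237.boxOpR (L^k) a_k m² M)⁻¹` obeys
* `thm19_zero_box_holder_roww` (§6, the master estimate):
  `Σ_z (L^k/|x′−x|_∞)^α·|L^k((G(xe′,z) − G(x′,z)) − (G(xe,z) − G(x,z)))|·e^{δ₀η·min(|x−z|_∞,|x′−z|_∞)} ≤ c₀`;
* `thm19_zero_box_holder_value` / `thm19_zero_box_holder_dist` (§7) — **THE HÖLDER CLAUSE (1.9) for rectangular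
  parallelepipeds at `A = 0`, with no restriction on `x, x′`**:
  `(L^k/|x′−x|_∞)^α·|L^k(((Gf)(xe′) − (Gf)(x′)) − ((Gf)(xe) − (Gf)(x)))| ≤ c₀·e^{−δ₀ηD}·F` for every `f`, every
  `F ≥ |f|` pointwise and every `D ≤ min(|x − z|_∞, |x′ − z|_∞) (z ∈ supp f)`, in particular
  `D = min(dsupp f x, dsupp f x′)`;
* `lemma22_zero_box_holder_sup` (§7) — **THE HÖLDER PART OF LEMMA 2.2 (2.16) AT `A = 0`** (the third entry of the norm
  (2.14) of `G_k(□)f`): the same `≤ c₀‖f‖_∞`;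
* `thm19_zero_box_holder_roww_coeff` / `thm19_zero_box_holder_value_coeff` (§7) — the same for the operator with the
  LITERAL coefficient `a` of (1.6) ranging over the window (instead of the running `a_k = B1.aSeq a L k`);
* `ineq19_110_zero_box` (§7) — **(1.9) AND (1.10) TOGETHER at `A = 0` for boxes with common `δ₀, c₀`**: the conjunction
  of the Hölder clause with `B4Thm110ZeroBoxDeriv.thm110_zero_box_deriv_dist` (derivative clause) and
  `B4Thm110ZeroBox.thm110_zero_box_dist` (value clause);
* §8: the statements are instantiated at `d + 1 = 4`, `L = 2`, `α = 1/2`, `a ∈ [1/2, 2]`, `m² ∈ [0, 1]` and their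
  binders are inhabited (`k = 1`, the unit cube, `x = 0`, `xe = e_0`, `x′ = e_1 ≠ x`, `xe′ = e_1 + e_0`), so nothing is
  vacuous.
On the way: the two-centre weighted `ℓ¹` functional of a vector about a pair of base points and its splitting rule
(§1, `wsum2`, `wsum2_split_le`), the real form of (2.36) (§2, `green_blockRowHolder_bound`), its transport to the fine
box with the factor `s_j^α s_j^{-1} = (L^jη)^{1−α}` of (2.38) (§3, `Gfine_blockRowHolder_bound`), the Hölder-differenced
step bound `≤ Θe^{δ₀}s_j^αs_j^{-1}` (§4, `step_termH_bound`) and the induction over `j` summed by the geometric series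
`Σ_j(L^{-j})^{1−α}` of (2.39), `< ∞` exactly because `α < 1` (§5, `Lratio_lt_one`, `Gfine_rowwH_bound`).

## DICTIONARY (typist's; each line is a reading, not a quotation; everything at `A = 0`, `U ≡ 1`, one component;
the dictionaries of `B4Thm110ZeroBox` / `B4Thm110ZeroBoxDeriv` for `□`, `G_k(□)`, `a_k`, `‖f‖_∞`, `dist(x, supp f)`,
`D^η_{0,μ} = ∂^η_μ`, (2.34) apply verbatim)

* `U(A(Γ_{x,x′}))` of (1.9)/(2.14) at `A = 0` is the identity ((1.2): `U(0) = 1`), so the left side of (1.9) is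
  `|x − x′|^{−α}|(∂^η_μG_k(□)f)(x′) − (∂^η_μG_k(□)f)(x)|` ↦
  `(L^k/supNorm (x′ − x))^α · |L^k·(((Gf) xe′ − (Gf) x′) − ((Gf) xe − (Gf) x))|` for sites `x, xe, x′, xe′` of the
  fine box with `xe.1 = x.1 + Pi.single μ 1`, `xe'.1 = x'.1 + Pi.single μ 1` (`η^{-1} = L^k`; `|x − x′| = η·supNorm`,
  `supNorm` = the `ℓ^∞` norm of `B4ContourShift`; both bonds `⟨x, x + ηe_μ⟩`, `⟨x′, x′ + ηe_μ⟩` lie in `□`, «bonds b ⊂ Ω»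
  of (1.3)); the kernel of the Hölder quotient ↦ `z ↦ (L^k/|x′−x|_∞)^α·L^k((G(xe′,z) − G(x′,z)) − (G(xe,z) − G(x,z)))`.
* `x ≠ x′` ↦ the binder `x'.1 ≠ x.1` (for `x = x′` the printed left side is `0·∞`; the print's `sup_{x,x′,μ}` in (2.14)
  is over `x ≠ x′`); then `|x′ − x|_∞ ≥ 1` in lattice units (`B4StripSumsHolder.one_le_supNorm`).
* `dist({x, x′}, supp f)` ↦ `η·min(dsupp f x, dsupp f x′)`, `dsupp` the `ℓ^∞` distance to `supp f` in fine-lattice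
  units (`B4Thm110ZeroBox.dsupp`); `dist({x,x′}, y)` of (2.36) ↦ `min(|blk_{b_j}x − y|_∞, |blk_{b_j}x′ − y|_∞)` at block
  resolution, as certified by `B4Green242Bridge.greenBoxQ_holder_decay_236_inv`.
* `∂^{L^{-j}}_μG_j(□)Q_j^*` of (2.36) ↦ the differenced block-row sums `b_j·Σ_{x″ ∈ B(y)}(G_j(□)(xe,x″) − G_j(□)(x,x″))`,
  doubly differenced between the pairs `(x′, xe′)` and `(x, xe)` and weighted by `(b_j/|x′−x|_∞)^α`; transported to
  `𝒢_j = s_j^{-2}G_j(□)` on the fine box with `L^k = s_jb_j`, `(L^k/|σ|)^α = s_j^α(b_j/|σ|)^α` (§3) — the weight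
  `(L^jη)^{1−α} = s_j^{-(1−α)}` of (2.38).
* «δ₀, c₀ […] depending on d, M only, c₀ on α also» ↦ `∀ α, 0 ≤ α → α < 1 → ∃ δ₀ c₀` depending on `d`, `ℓ`, `α` and the
  window — uniform in `k ≥ 1`, in the box, in `μ`, in the points and in `(a, m²)`; here `δ₀` may depend on `α` too (it
  is inherited from the rate of (2.36) in `B4Green242Bridge`), the quantifier order of the typed leaf `B4.ThmPrinted`
  (`∀ α : ℝ, α < 1 → ∃ δ₀ c₀ R₀ …`).
* `0 ≤ α`: the print says only «α < 1»; for `α < 0` the weight `|x − x′|^{−α}` GROWS with the distance and (1.9) is not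
  uniformly true as printed (nor meant: (2.14) is a Hölder norm), so the certified range is `0 ≤ α < 1` — the binder
  `(hα0 : 0 ≤ α)`, as in `B4Green242Bridge` (2.36).

## HONEST SCOPE — what is NOT certified here

(i) Only `A = 0` (so `U ≡ 1`, `D^η_{A,μ} = ∂^η_μ`, «e sufficiently small» and regularity are void, one component).
(ii) Only `Ω = □ = Π_μ[0, M_μ)` with integer sides (unions of UNIT blocks, p. 584); general `Ω` with
`dist({x,x′}, Ω^c) ≥ R₀` (the random-walk expansion (2.13), (2.18)–(2.22)) is NOT treated, and no `R₀` appears.  (iii)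
Only the Hölder quotient of the FORWARD derivative `∂^η_μG_k(□)` in the ROW variable, `0 ≤ α < 1`, both points with
their `μ`-neighbours in `□`; NOT the Hölder statements for `δG_k` (1.11)–(1.12) or for Corollary 2.3, NOT (2.17), NOT
the `L^p → L^q` scale.  The value and derivative clauses of (1.10) are `B4Thm110ZeroBox` / `B4Thm110ZeroBoxDeriv` (only
re-packaged in `ineq19_110_zero_box`).  (iv) The constants are existential and depend on `d`, `ℓ`, `α` and the window
(print: `δ₀` «on d, M only», `c₀` «on α also»); the decay rate is `δ₀` per unit of `η`-scaled sup distance and the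
Hölder weight is the sup-norm one (Euclidean `≥` sup on both counts, so the printed Euclidean form follows with
`δ₀/√(d+1)` and the same `c₀`).  (v) ROUTE: the print's box route of pp. 582–583 — (2.34) one step at a time
(`B4Thm110ZeroBox.Gfine_succ_sub`), doubly differenced in the row variable and Hölder-weighted, with (2.36) in block-row
form (`B4Green242Bridge.greenBoxQ_holder_decay_236_inv`, real form §2), the value half of (2.35)
(`B4Thm110ZeroBox.Gfine_blockRow_bound`) and (2.37) (`B4BoxCov237.cov237_box_decay`) as kernel-proved inputs; the
`j`-th step costs `s_j^{-(1−α)} = (L^{-(k-j)})^{1−α}` (the `(L^jη)^{1−α}` of (2.38)–(2.39)), summed by the geometric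
series with ratio `L^{-(1−α)} < 1`; the two-centre decay `dist({x,x′}, ·)` is carried by the functional `wsum2` and
the split of the block-row vector according to the nearer of `blk x`, `blk x′` (§4); the `j = 1` start («η^{1−α}4c₀O(1)»
of (2.39)) is the one-step box Green's function of `B4Thm110ZeroBox` §7, doubly differenced crudely (four entries,
`(L^k/|x′−x|)^α ≤ L^k`, `(L^k)²s_1^{-2} = L²`) — it is NOT the print's general proof of Proposition 2.1.  (vi) This file
does not touch `DagBinding`/`DagDischarged` (the carver's) nor `B4Prop31Zero`; whether and how the abstract
`B4.Ineq19_110` / `B4.ThmPrinted` of the binding is instantiated from `ineq19_110_zero_box` is the carver's call.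

**Value = kernel certificate (the print's (1.9) Hölder clause at `A = 0` on boxes, all scales and all `0 ≤ α < 1`, by
the print's own renormalization-group route over the package's `A = 0` theorems), NOT summit progress**: the
Yang–Mills / `Summit.QuantumFields` statements are untouched; no Literature fact is minted — every hypothesis used is
kernel-proved in this package.
-/

namespace Literature.MathematicalPhysics.QuantumFieldTheory.Balaban1983to89.B4Thm19ZeroBoxHolder

open Finset Matrix
open Literature.MathematicalPhysics.QuantumFieldTheory.Balaban1983to89.B4ContourShift
open Literature.MathematicalPhysics.QuantumFieldTheory.Balaban1983to89.B4Reflection242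
open Literature.MathematicalPhysics.QuantumFieldTheory.Balaban1983to89.B4Green242Bridge
open Literature.MathematicalPhysics.QuantumFieldTheory.Balaban1983to89.B4BoxCov237
open Literature.MathematicalPhysics.QuantumFieldTheory.Balaban1983to89.B4Thm110ZeroBox
open Literature.MathematicalPhysics.QuantumFieldTheory.Balaban1983to89.B4Thm110ZeroBoxDeriv
open B4StripSumsHolder (one_le_supNorm)
open B4Sect5Torus (IsPseudoDist SumBound Hyp56 rate rate_pos inv_decay)
open B4Sect5Proof (latticeConst latticeConst_nonneg latticeSum_le)

noncomputable section

variable {d : ℕ}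

/-! ## §1 The two-centre weighted `ℓ¹` functional of a vector about a PAIR of base points `x, x′` -/

section WSum2

variable {N : Fin (d + 1) → ℕ}

/-- the TWO-CENTRE WEIGHTED `ℓ¹` FUNCTIONAL of a vector about the pair `x, x′`:
`Σ_z |g(z)|·e^{δ₀·min(|x − z|_∞, |x′ − z|_∞)/n}` (`n = L^k`; `min(|x − z|, |x′ − z|) = dist({x,x′}, z)` of (1.9)).
[folklore] -/
def wsum2 (δ₀ : ℝ) (n : ℕ) (x x' : ↥(boxDom N)) (g : ↥(boxDom N) → ℝ) : ℝ :=
  ∑ z, |g z| * Real.exp (δ₀ * min (supNorm (x.1 - z.1)) (supNorm (x'.1 - z.1)) / n)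

/-- the two-centre functional is nonnegative. [folklore] -/
theorem wsum2_nonneg (δ₀ : ℝ) (n : ℕ) (x x' : ↥(boxDom N)) (g : ↥(boxDom N) → ℝ) : 0 ≤ wsum2 δ₀ n x x' g :=
  Finset.sum_nonneg fun _ _ => mul_nonneg (abs_nonneg _) (Real.exp_pos _).le

/-- subadditivity. [folklore] -/
theorem wsum2_add_le (δ₀ : ℝ) (n : ℕ) (x x' : ↥(boxDom N)) (g h : ↥(boxDom N) → ℝ) :
    wsum2 δ₀ n x x' (fun z => g z + h z) ≤ wsum2 δ₀ n x x' g + wsum2 δ₀ n x x' h := by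
  unfold wsum2
  rw [← Finset.sum_add_distrib]
  refine Finset.sum_le_sum fun z _ => ?_
  rw [← add_mul]
  exact mul_le_mul_of_nonneg_right (abs_add_le _ _) (Real.exp_pos _).le

/-- homogeneity. [folklore] -/
theorem wsum2_mul_left (δ₀ : ℝ) (n : ℕ) (x x' : ↥(boxDom N)) {c : ℝ} (hc : 0 ≤ c) (g : ↥(boxDom N) → ℝ) :
    wsum2 δ₀ n x x' (fun z => c * g z) = c * wsum2 δ₀ n x x' g := by
  unfold wsum2
  rw [Finset.mul_sum]
  refine Finset.sum_congr rfl fun z _ => ?_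
  rw [abs_mul, abs_of_nonneg hc, mul_assoc]

/-- the two-centre weight is dominated by the one-centre weight about `x` (`δ₀ ≥ 0`). [folklore] -/
theorem wsum2_le_wsum_left {δ₀ : ℝ} (hδ : 0 ≤ δ₀) (n : ℕ) (x x' : ↥(boxDom N)) (g : ↥(boxDom N) → ℝ) :
    wsum2 δ₀ n x x' g ≤ wsum δ₀ n x g := by
  unfold wsum2 wsum
  refine Finset.sum_le_sum fun z _ => mul_le_mul_of_nonneg_left ?_ (abs_nonneg _)
  refine Real.exp_le_exp.2 (div_le_div_of_nonneg_right ?_ (Nat.cast_nonneg n))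
  exact mul_le_mul_of_nonneg_left (min_le_left _ _) hδ

/-- … and by the one-centre weight about `x′`. [folklore] -/
theorem wsum2_le_wsum_right {δ₀ : ℝ} (hδ : 0 ≤ δ₀) (n : ℕ) (x x' : ↥(boxDom N)) (g : ↥(boxDom N) → ℝ) :
    wsum2 δ₀ n x x' g ≤ wsum δ₀ n x' g := by
  unfold wsum2 wsum
  refine Finset.sum_le_sum fun z _ => mul_le_mul_of_nonneg_left ?_ (abs_nonneg _)
  refine Real.exp_le_exp.2 (div_le_div_of_nonneg_right ?_ (Nat.cast_nonneg n))
  exact mul_le_mul_of_nonneg_left (min_le_right _ _) hδ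

/-- **THE SPLITTING RULE**: a vector written as `g = g₁ + g₂` with `g₁` controlled about `x` and `g₂` about `x′` has
two-centre functional `≤ Σ|g₁|e^{δ₀|x−·|/n} + Σ|g₂|e^{δ₀|x′−·|/n}`. [folklore] -/
theorem wsum2_split_le {δ₀ : ℝ} (hδ : 0 ≤ δ₀) (n : ℕ) (x x' : ↥(boxDom N)) (g g₁ g₂ : ↥(boxDom N) → ℝ)
    (hg : ∀ z, g z = g₁ z + g₂ z) :
    wsum2 δ₀ n x x' g ≤ wsum δ₀ n x g₁ + wsum δ₀ n x' g₂ := by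
  have hfun : g = fun z => g₁ z + g₂ z := funext hg
  rw [hfun]
  exact (wsum2_add_le δ₀ n x x' g₁ g₂).trans
    (add_le_add (wsum2_le_wsum_left hδ n x x' g₁) (wsum2_le_wsum_right hδ n x x' g₂))

/-- monotonicity in the weight rate (`δ₁ ≤ δ₀`). [folklore] -/
theorem wsum2_mono_rate {δ₁ δ₀ : ℝ} (h : δ₁ ≤ δ₀) (n : ℕ) (x x' : ↥(boxDom N)) (g : ↥(boxDom N) → ℝ) :
    wsum2 δ₁ n x x' g ≤ wsum2 δ₀ n x x' g := by
  unfold wsum2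
  refine Finset.sum_le_sum fun z _ => mul_le_mul_of_nonneg_left ?_ (abs_nonneg _)
  refine Real.exp_le_exp.2 (div_le_div_of_nonneg_right ?_ (Nat.cast_nonneg n))
  exact mul_le_mul_of_nonneg_right h (le_min (supNorm_nonneg _) (supNorm_nonneg _))

/-- **FROM THE TWO-CENTRE WEIGHTED BOUND TO THE PRINTED FORM**: if `Σ_z|g(z)|e^{δ₀min(|x−z|,|x′−z|)/n} ≤ c₀`,
`|f| ≤ F` and `D ≤ min(|x − z|_∞, |x′ − z|_∞)` on `supp f` (`D ≤ dist({x,x′}, supp f)` in fine units), then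
`|Σ_z g(z)f(z)| ≤ c₀e^{−δ₀D/n}F`. [folklore] -/
theorem abs_sum_mul_le_of_wsum2 {δ₀ c₀ : ℝ} (hδ : 0 ≤ δ₀) (n : ℕ) (x x' : ↥(boxDom N)) (g : ↥(boxDom N) → ℝ)
    (hw : wsum2 δ₀ n x x' g ≤ c₀) (f : ↥(boxDom N) → ℝ) {F D : ℝ}
    (hF : ∀ z, |f z| ≤ F) (hD : ∀ z, f z ≠ 0 → D ≤ min (supNorm (x.1 - z.1)) (supNorm (x'.1 - z.1))) :
    |∑ z, g z * f z| ≤ c₀ * Real.exp (-(δ₀ * D / n)) * F := by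
  have hF0 : 0 ≤ F := (abs_nonneg _).trans (hF x)
  have h1 : |∑ z, g z * f z| ≤ ∑ z, |g z| * |f z| :=
    (Finset.abs_sum_le_sum_abs _ _).trans (le_of_eq (Finset.sum_congr rfl fun z _ => abs_mul _ _))
  have h2 : ∀ z, |g z| * |f z|
      ≤ |g z| * Real.exp (δ₀ * min (supNorm (x.1 - z.1)) (supNorm (x'.1 - z.1)) / n)
          * (Real.exp (-(δ₀ * D / n)) * F) := by
    intro z
    by_cases hfz : f z = 0
    · rw [hfz, abs_zero, mul_zero]
      positivity
    · have hDz := hD z hfz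
      have he : 1 ≤ Real.exp (δ₀ * min (supNorm (x.1 - z.1)) (supNorm (x'.1 - z.1)) / n)
          * Real.exp (-(δ₀ * D / n)) := by
        rw [← Real.exp_add]
        apply Real.one_le_exp
        have h0 : 0 ≤ δ₀ * (min (supNorm (x.1 - z.1)) (supNorm (x'.1 - z.1)) - D) / n :=
          div_nonneg (mul_nonneg hδ (sub_nonneg.2 hDz)) n.cast_nonneg
        have heq : δ₀ * min (supNorm (x.1 - z.1)) (supNorm (x'.1 - z.1)) / n + -(δ₀ * D / n)
            = δ₀ * (min (supNorm (x.1 - z.1)) (supNorm (x'.1 - z.1)) - D) / n := by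
          ring
        rw [heq]
        exact h0
      calc |g z| * |f z| ≤ |g z| * F := mul_le_mul_of_nonneg_left (hF z) (abs_nonneg _)
        _ ≤ |g z| * F * (Real.exp (δ₀ * min (supNorm (x.1 - z.1)) (supNorm (x'.1 - z.1)) / n)
              * Real.exp (-(δ₀ * D / n))) :=
            le_mul_of_one_le_right (mul_nonneg (abs_nonneg _) hF0) he
        _ = _ := by ring
  calc |∑ z, g z * f z| ≤ ∑ z, |g z| * |f z| := h1
    _ ≤ ∑ z, |g z| * Real.exp (δ₀ * min (supNorm (x.1 - z.1)) (supNorm (x'.1 - z.1)) / n)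
          * (Real.exp (-(δ₀ * D / n)) * F) := Finset.sum_le_sum fun z _ => h2 z
    _ = wsum2 δ₀ n x x' g * (Real.exp (-(δ₀ * D / n)) * F) := by rw [wsum2, Finset.sum_mul]
    _ ≤ c₀ * (Real.exp (-(δ₀ * D / n)) * F) := mul_le_mul_of_nonneg_right hw (by positivity)
    _ = c₀ * Real.exp (-(δ₀ * D / n)) * F := by ring

end WSum2

/-- doubly differencing a triple matrix product in the row index:
`t·(((ACB)(p′,z) − (ACB)(q′,z)) − ((ACB)(p,z) − (ACB)(q,z))) = Σ_{y′}Σ_y (t((A(p′,y) − A(q′,y)) − (A(p,y) − A(q,y))))·C(y,y′)·B(y′,z)`.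
[folklore] -/
theorem mul3_row_dd {α β γ ε : Type*} [Fintype β] [Fintype γ] (A : Matrix α β ℝ) (C : Matrix β γ ℝ)
    (B : Matrix γ ε ℝ) (p' q' p q : α) (z : ε) (t : ℝ) :
    t * (((A * C * B) p' z - (A * C * B) q' z) - ((A * C * B) p z - (A * C * B) q z))
      = ∑ y', ∑ y, t * ((A p' y - A q' y) - (A p y - A q y)) * C y y' * B y' z := by
  rw [mul_sub, mul3_row_sub, mul3_row_sub, ← Finset.sum_sub_distrib]
  refine Finset.sum_congr rfl fun y' _ => ?_
  rw [← Finset.sum_sub_distrib]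
  refine Finset.sum_congr rfl fun y _ => ?_
  ring

/-! ## §2 The Hölder half (2.36) of Lemma 2.4 in real form -/

/-- real form of the complex doubly-differenced block row. [folklore] -/
theorem blockRowDD_real {n : ℕ} (hn : 1 ≤ n) {a m2 : ℝ} (ha : 0 < a) (hm : 0 ≤ m2) {M : Fin (d + 1) → ℕ}
    (hM : ∀ i, 1 ≤ M i) (x xe x' xe' : ↥(boxDom (fun i => n * M i))) (y : Fin (d + 1) → ℤ) :
    ((n : ℂ) * ∑ x'' : ↥(boxDom (fun i => n * M i)),
        (if blk n x''.1 = y then ((boxOp n a m2 M)⁻¹ xe' x'' - (boxOp n a m2 M)⁻¹ x' x'')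
          - ((boxOp n a m2 M)⁻¹ xe x'' - (boxOp n a m2 M)⁻¹ x x'') else 0))
      = (((n : ℝ) * ∑ x'' : ↥(boxDom (fun i => n * M i)),
          (if blk n x''.1 = y then ((boxOpR n a m2 M)⁻¹ xe' x'' - (boxOpR n a m2 M)⁻¹ x' x'')
            - ((boxOpR n a m2 M)⁻¹ xe x'' - (boxOpR n a m2 M)⁻¹ x x'') else 0) : ℝ) : ℂ) := by
  rw [boxOp_inv_eq_map hn ha hm hM]
  push_cast
  congr 1
  refine Finset.sum_congr rfl fun x'' _ => ?_
  split_ifs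
  · simp [Matrix.map_apply]
  · simp

/-- **(2.36) FOR THE NEUMANN BOX GREEN FUNCTION, real form** [B4 Lemma 2.4 (2.36), kernel-proved in
`B4Green242Bridge.greenBoxQ_holder_decay_236_inv`]: for `0 ≤ α < 1`,
`(n/|x′ − x|_∞)^α·|n·Σ_{x″ ∈ B(y)}[(G(□)(x′+e_μ,x″) − G(□)(x′,x″)) − (G(□)(x+e_μ,x″) − G(□)(x,x″))]|
≤ C·e^{−κ·min(|blk x − y|_∞, |blk x′ − y|_∞)}`, uniformly in `n`, the box and the window — i.e.
«|x−x′|^{−α}|(∂^{L^{−j}}_μG_j(□)Q_j^*)(x,y) − (∂^{L^{−j}}_μG_j(□)Q_j^*)(x′,y)| ≤ c₁e^{−δ₀dist({x,x′},y)}».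
[cite: Balaban1983RegularityDecay, p. 582 Lemma 2.4 (2.36); kernel-proved in `B4Green242Bridge`] -/
theorem green_blockRowHolder_bound (d : ℕ) (aminus aplus m2plus : ℝ) (ha : 0 < aminus) {α : ℝ} (hα0 : 0 ≤ α)
    (hα1 : α < 1) :
    ∃ κ C : ℝ, 0 < κ ∧ 0 ≤ C ∧ ∀ (n : ℕ), 1 ≤ n → ∀ (a m2 : ℝ), aminus ≤ a → a ≤ aplus → 0 ≤ m2 → m2 ≤ m2plus →
      ∀ (M : Fin (d + 1) → ℕ), (∀ i, 1 ≤ M i) →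
        ∀ (μ : Fin (d + 1)) (x xe x' xe' : ↥(boxDom (fun i => n * M i))), xe.1 = x.1 + Pi.single μ 1 →
          xe'.1 = x'.1 + Pi.single μ 1 → x'.1 ≠ x.1 →
        ∀ (y : Fin (d + 1) → ℤ), y ∈ boxDom M →
          ((n : ℝ) / supNorm (x'.1 - x.1)) ^ α *
              |(n : ℝ) * ∑ x'' : ↥(boxDom (fun i => n * M i)),
                (if blk n x''.1 = y then ((boxOpR n a m2 M)⁻¹ xe' x'' - (boxOpR n a m2 M)⁻¹ x' x'')
                  - ((boxOpR n a m2 M)⁻¹ xe x'' - (boxOpR n a m2 M)⁻¹ x x'') else 0)|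
            ≤ C * Real.exp (-(κ * min (supNorm (blk n x.1 - y)) (supNorm (blk n x'.1 - y)))) := by
  obtain ⟨κ, C, hκ, hC, h⟩ := greenBoxQ_holder_decay_236_inv d aminus aplus m2plus ha hα0 hα1
  refine ⟨κ, C, hκ, hC, fun n hn a m2 h1 h2 h3 h4 M hM μ x xe x' xe' hxe hxe' hne y hy => ?_⟩
  have hb := (h n hn a m2 h1 h2 h3 h4 M hM).2 μ x xe x' xe' hxe hxe' hne y hy
  rw [blockRowDD_real hn (lt_of_lt_of_le ha h1) h3 hM, Complex.norm_real, Real.norm_eq_abs] at hb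
  exact hb

/-! ## §3 Transport of the Hölder block-row bound (2.36) to the fine box: the factor `s_j^α·s_j^{-1} = (L^jη)^{1−α}` -/

/-- `L^k = s_j·b_j` in `ℝ`. [folklore] -/
theorem Lk_eq_sc_mul_bj {ℓ k j : ℕ} (hj : j ≤ k) :
    ((((ℓ + 1) ^ k : ℕ)) : ℝ) = sc ℓ k j * ((bj ℓ j : ℕ) : ℝ) := by
  rw [sc_mul_bj hj]
  push_cast
  ring

/-- **DOUBLY DIFFERENCED, HÖLDER-WEIGHTED BLOCK-ROW SUMS OF `𝒢_j` DECAY ABOUT THE PAIR** — transport of (2.36) to the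
fine box `□ ∩ ηℤ^{d+1}` (`𝒢_j = s_j^{-2}G_j`, `L^k = s_jb_j`): for lattice neighbours `xe = x + e_μ`, `xe′ = x′ + e_μ`,
`x′ ≠ x`,
`(L^k/|x′−x|_∞)^α·|L^k·Σ_{x″ : blk_{b_j}x″ = y}[(𝒢_j(xe′,x″) − 𝒢_j(x′,x″)) − (𝒢_j(xe,x″) − 𝒢_j(x,x″))]|
≤ s_j^α·s_j^{-1}·C·e^{−κ·min(|blk_{b_j}x − y|, |blk_{b_j}x′ − y|)}` — the factor `(L^jη)^{1−α}` of [B4] (2.38).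
[cite: Balaban1983RegularityDecay, p. 582 Lemma 2.4 (2.36), (2.38)] -/
theorem Gfine_blockRowHolder_bound (d ℓ : ℕ) (hℓ : 1 ≤ ℓ) (aminus aplus m2plus : ℝ) (ha : 0 < aminus)
    {α : ℝ} (hα0 : 0 ≤ α) (hα1 : α < 1) :
    ∃ κ C : ℝ, 0 < κ ∧ 0 ≤ C ∧ ∀ (k j : ℕ), 1 ≤ j → ∀ (hj : j + 1 ≤ k), ∀ (a m2 : ℝ), aminus ≤ a → a ≤ aplus →
      0 ≤ m2 → m2 ≤ m2plus → ∀ (M : Fin (d + 1) → ℕ), (∀ i, 1 ≤ M i) →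
        ∀ (μ : Fin (d + 1)) (x xe x' xe' : ↥(boxDom (Nf ℓ k M))), xe.1 = x.1 + Pi.single μ 1 →
          xe'.1 = x'.1 + Pi.single μ 1 → x'.1 ≠ x.1 →
        ∀ (y : Fin (d + 1) → ℤ), y ∈ boxDom (Mj ℓ k M j) →
          ((((ℓ + 1) ^ k : ℕ) : ℝ) / supNorm (x'.1 - x.1)) ^ α *
            |(((ℓ + 1) ^ k : ℕ) : ℝ) * ∑ x'' : ↥(boxDom (Nf ℓ k M)),
              (if blk (bj ℓ j) x''.1 = y then
                (Gfine ℓ k M j a m2 xe' x'' - Gfine ℓ k M j a m2 x' x'')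
                  - (Gfine ℓ k M j a m2 xe x'' - Gfine ℓ k M j a m2 x x'') else 0)|
            ≤ sc ℓ k j ^ α * (sc ℓ k j)⁻¹ * C *
                Real.exp (-(κ * min (supNorm (blk (bj ℓ j) x.1 - y)) (supNorm (blk (bj ℓ j) x'.1 - y)))) := by
  obtain ⟨κ, C, hκ, hC, h⟩ := green_blockRowHolder_bound d (aminus * (1 - ((((ℓ : ℝ) + 1)) ^ 2)⁻¹))
    aplus m2plus (aminus'_pos hℓ ha) hα0 hα1
  refine ⟨κ, C, hκ, hC, fun k j hj1 hj a m2 h1 h2 h3 h4 M hM μ x xe x' xe' hxe hxe' hne y hy => ?_⟩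
  have ha0 : 0 < a := lt_of_lt_of_le ha h1
  obtain ⟨hw1, hw2, hapos⟩ := aSeq_window hℓ ha h1 h2 hj1
  have hs : 0 < sc ℓ k j ^ 2 := pow_pos (sc_pos ℓ k j) 2
  have hsc0 : sc ℓ k j ≠ 0 := (sc_pos ℓ k j).ne'
  have hm' : 0 ≤ m2 / sc ℓ k j ^ 2 := div_nonneg h3 hs.le
  have hm'' : m2 / sc ℓ k j ^ 2 ≤ m2plus := (div_le_self h3 (one_le_pow₀ (one_le_sc ℓ k j))).trans h4
  have hxe1 : ((ej ℓ k M j hj).symm xe).1 = ((ej ℓ k M j hj).symm x).1 + Pi.single μ 1 := hxe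
  have hxe1' : ((ej ℓ k M j hj).symm xe').1 = ((ej ℓ k M j hj).symm x').1 + Pi.single μ 1 := hxe'
  have hne1 : ((ej ℓ k M j hj).symm x').1 ≠ ((ej ℓ k M j hj).symm x).1 := hne
  have hrow := h (bj ℓ j) (bj_pos ℓ j) _ _ hw1 hw2 hm' hm'' (Mj ℓ k M j) (Mj_pos hM) μ
    ((ej ℓ k M j hj).symm x) ((ej ℓ k M j hj).symm xe) ((ej ℓ k M j hj).symm x') ((ej ℓ k M j hj).symm xe')
    hxe1 hxe1' hne1 y hy
  have hxv : ((ej ℓ k M j hj).symm x).1 = x.1 := rfl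
  have hxv' : ((ej ℓ k M j hj).symm x').1 = x'.1 := rfl
  rw [hxv, hxv'] at hrow
  -- the weight `(n/|σ|)^α·|n·S|` of the scale-`j` box, `n = b_j`
  set W : ℝ := (((bj ℓ j : ℕ) : ℝ) / supNorm (x'.1 - x.1)) ^ α with hW
  have hσ1 : 1 ≤ supNorm (x'.1 - x.1) := one_le_supNorm (sub_ne_zero.2 hne)
  have hσ0 : 0 < supNorm (x'.1 - x.1) := lt_of_lt_of_le one_pos hσ1
  have hW0 : 0 ≤ W := Real.rpow_nonneg (div_nonneg (Nat.cast_nonneg _) hσ0.le) α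
  have hsum : ∑ x'' : ↥(boxDom (Nf ℓ k M)),
      (if blk (bj ℓ j) x''.1 = y then
        (Gfine ℓ k M j a m2 xe' x'' - Gfine ℓ k M j a m2 x' x'')
          - (Gfine ℓ k M j a m2 xe x'' - Gfine ℓ k M j a m2 x x'') else 0)
      = (sc ℓ k j ^ 2)⁻¹ * ∑ z : ↥(boxDom (fun i => bj ℓ j * Mj ℓ k M j i)),
          (if blk (bj ℓ j) z.1 = y then
            ((boxOpR (bj ℓ j) (B1.aSeq a ((ℓ : ℝ) + 1) j) (m2 / sc ℓ k j ^ 2) (Mj ℓ k M j))⁻¹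
                ((ej ℓ k M j hj).symm xe') z
              - (boxOpR (bj ℓ j) (B1.aSeq a ((ℓ : ℝ) + 1) j) (m2 / sc ℓ k j ^ 2) (Mj ℓ k M j))⁻¹
                ((ej ℓ k M j hj).symm x') z)
            - ((boxOpR (bj ℓ j) (B1.aSeq a ((ℓ : ℝ) + 1) j) (m2 / sc ℓ k j ^ 2) (Mj ℓ k M j))⁻¹
                ((ej ℓ k M j hj).symm xe) z
              - (boxOpR (bj ℓ j) (B1.aSeq a ((ℓ : ℝ) + 1) j) (m2 / sc ℓ k j ^ 2) (Mj ℓ k M j))⁻¹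
                ((ej ℓ k M j hj).symm x) z) else 0) := by
    rw [sum_Nf_eq_sum_ej hj, Finset.mul_sum]
    refine Finset.sum_congr rfl fun z _ => ?_
    have hzv : (ej ℓ k M j hj z).1 = z.1 := rfl
    rw [hzv]
    split_ifs with hz
    · rw [Gfine_apply hℓ hj1 hj hM ha0 h3, Gfine_apply hℓ hj1 hj hM ha0 h3, Gfine_apply hℓ hj1 hj hM ha0 h3,
        Gfine_apply hℓ hj1 hj hM ha0 h3, Equiv.symm_apply_apply]
      ring
    · rw [mul_zero]
  have hnR : ((((ℓ + 1) ^ k : ℕ)) : ℝ) = sc ℓ k j * ((bj ℓ j : ℕ) : ℝ) := Lk_eq_sc_mul_bj (by omega)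
  have heq : ∀ S : ℝ, (((ℓ + 1) ^ k : ℕ) : ℝ) * ((sc ℓ k j ^ 2)⁻¹ * S)
      = (sc ℓ k j)⁻¹ * (((bj ℓ j : ℕ) : ℝ) * S) := by
    intro S
    rw [hnR]
    field_simp
  -- the Hölder weight of the fine box splits as `s_j^α · W`
  have hwt : ((((ℓ + 1) ^ k : ℕ) : ℝ) / supNorm (x'.1 - x.1)) ^ α = sc ℓ k j ^ α * W := by
    rw [hW, hnR, mul_div_assoc, Real.mul_rpow (sc_pos ℓ k j).le (div_nonneg (Nat.cast_nonneg _) hσ0.le)]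
  rw [hsum, heq, abs_mul, abs_of_pos (inv_pos.2 (sc_pos ℓ k j)), hwt]
  have hsα : 0 ≤ sc ℓ k j ^ α := Real.rpow_nonneg (sc_pos ℓ k j).le α
  calc sc ℓ k j ^ α * W * ((sc ℓ k j)⁻¹ * |((bj ℓ j : ℕ) : ℝ) * _|)
      = sc ℓ k j ^ α * (sc ℓ k j)⁻¹ * (W * |((bj ℓ j : ℕ) : ℝ) * _|) := by ring
    _ ≤ sc ℓ k j ^ α * (sc ℓ k j)⁻¹ *
        (C * Real.exp (-(κ * min (supNorm (blk (bj ℓ j) x.1 - y)) (supNorm (blk (bj ℓ j) x'.1 - y))))) :=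
        mul_le_mul_of_nonneg_left hrow (mul_nonneg hsα (inv_pos.2 (sc_pos ℓ k j)).le)
    _ = _ := by ring

/-- pulling a weight and a scalar through the doubly differenced row of a scaled triple product:
`W·(t·(((s·ACB)(p′,z) − (s·ACB)(q′,z)) − ((s·ACB)(p,z) − (s·ACB)(q,z)))) = s·Σ_{y′}Σ_y (W·(t·ddA(y)))·C(y,y′)·B(y′,z)`.
[folklore] -/
theorem weight_smul_mul3_row_dd {α' β γ ε : Type*} [Fintype β] [Fintype γ] (A : Matrix α' β ℝ)
    (C : Matrix β γ ℝ) (B : Matrix γ ε ℝ) (p' q' p q : α') (z : ε) (s W t : ℝ) :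
    W * (t * (((s • (A * C * B)) p' z - (s • (A * C * B)) q' z)
        - ((s • (A * C * B)) p z - (s • (A * C * B)) q z)))
      = s * ∑ y', ∑ y, (W * (t * ((A p' y - A q' y) - (A p y - A q y)))) * C y y' * B y' z := by
  simp only [Matrix.smul_apply, smul_eq_mul]
  have h := mul3_row_dd A C B p' q' p q z (W * t)
  calc W * (t * ((s * (A * C * B) p' z - s * (A * C * B) q' z) - (s * (A * C * B) p z - s * (A * C * B) q z)))
      = s * ((W * t) * (((A * C * B) p' z - (A * C * B) q' z) - ((A * C * B) p z - (A * C * B) q z))) := by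
        ring
    _ = s * ∑ y', ∑ y, (W * t) * ((A p' y - A q' y) - (A p y - A q y)) * C y y' * B y' z := by rw [h]
    _ = _ := by
        congr 1
        refine Finset.sum_congr rfl fun y' _ => Finset.sum_congr rfl fun y _ => ?_
        ring

/-! ## §4 The Hölder-differenced fluctuation term of one renormalization step

With `A_j = 𝒢_jQ_j^*`, `B_j = Q_j𝒢_j`, `C_j = s_j^{-2}C^{(j)}(□)` and `𝒢_{j+1} − 𝒢_j = α_j²·A_jC_jB_j`
(`B4Thm110ZeroBox.Gfine_succ_sub`, the (2.34) recursion), the doubly differenced, `L^k`-scaled and Hölder-weighted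
row of the step is `α_j²·Σ_{y′,y} g_H(y)C_j(y,y′)B_j(y′,z)` with
`g_H(y) = (L^k/|x′−x|)^α·L^k·((A_j(xe′,y) − A_j(x′,y)) − (A_j(xe,y) − A_j(x,y)))`,
`|g_H(y)| ≤ s_j^α s_j^{-1}C′e^{−κ·min(|blk x−y|, |blk x′−y|)}` (§3): the factor `s_j^{-2}` of the value estimate is
replaced by `s_j^{-(1−α)}` — exactly the `(L^jη)^{1−α}` of [B4] (2.38)–(2.39).  The two-centre decay is handled by
splitting `g_H = g₁ + g₂` according to which of `blk x`, `blk x′` is nearer to `y` and applying the triple-product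
estimate of `B4Thm110ZeroBoxDeriv` §2 about `x` to `g₁` and about `x′` to `g₂`. -/

section StepBound

variable {ℓ k j : ℕ} {M : Fin (d + 1) → ℕ} {a m2 : ℝ}

set_option maxHeartbeats 1600000 in
/-- **THE HÖLDER-DIFFERENCED STEP BOUND**: for `0 ≤ α < 1` there are `κ₀ > 0`, `Θ ≥ 0` (depending on `d, ℓ, α` and
the window only) such that for every weight rate `0 ≤ δ₀ ≤ κ₀`, every `1 ≤ j < k`, every point of the window, every
box, every axis `μ` and all lattice neighbours `xe = x + e_μ`, `xe′ = x′ + e_μ` of the fine box with `x′ ≠ x`: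
`Σ_z (L^k/|x′−x|_∞)^α·L^k·|((𝒢_{j+1} − 𝒢_j)(xe′,z) − (𝒢_{j+1} − 𝒢_j)(x′,z)) − ((𝒢_{j+1} − 𝒢_j)(xe,z) − (𝒢_{j+1} − 𝒢_j)(x,z))|
·e^{δ₀min(|x−z|,|x′−z|)/L^k} ≤ Θe^{δ₀}·s_j^α s_j^{-1}`. [folklore] -/
theorem step_termH_bound (d ℓ : ℕ) (hℓ : 1 ≤ ℓ) (amin aplus m2plus : ℝ) (ha : 0 < amin) {α : ℝ} (hα0 : 0 ≤ α)
    (hα1 : α < 1) :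
    ∃ κ₀ Θ : ℝ, 0 < κ₀ ∧ 0 ≤ Θ ∧ ∀ (δ₀ : ℝ), 0 ≤ δ₀ → δ₀ ≤ κ₀ →
      ∀ (k j : ℕ), 1 ≤ j → ∀ (hj : j + 1 ≤ k), ∀ (a m2 : ℝ), amin ≤ a → a ≤ aplus → 0 ≤ m2 →
        m2 ≤ m2plus → ∀ (M : Fin (d + 1) → ℕ), (∀ i, 1 ≤ M i) →
        ∀ (μ : Fin (d + 1)) (x xe x' xe' : ↥(boxDom (Nf ℓ k M))), xe.1 = x.1 + Pi.single μ 1 →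
          xe'.1 = x'.1 + Pi.single μ 1 → x'.1 ≠ x.1 →
          wsum2 δ₀ ((ℓ + 1) ^ k) x x' (fun z => ((((ℓ + 1) ^ k : ℕ) : ℝ) / supNorm (x'.1 - x.1)) ^ α *
              ((((ℓ + 1) ^ k : ℕ) : ℝ) *
                (((Gfine ℓ k M (j + 1) a m2 - Gfine ℓ k M j a m2) xe' z
                    - (Gfine ℓ k M (j + 1) a m2 - Gfine ℓ k M j a m2) x' z)
                  - ((Gfine ℓ k M (j + 1) a m2 - Gfine ℓ k M j a m2) xe z
                    - (Gfine ℓ k M (j + 1) a m2 - Gfine ℓ k M j a m2) x z))))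
            ≤ Θ * Real.exp δ₀ * (sc ℓ k j ^ α * (sc ℓ k j)⁻¹) := by
  obtain ⟨κ, C₁, hκ, hC₁, hR⟩ := Gfine_blockRow_bound d ℓ hℓ amin aplus m2plus ha
  obtain ⟨κ', C', hκ', hC', hHf⟩ := Gfine_blockRowHolder_bound d ℓ hℓ amin aplus m2plus ha hα0 hα1
  obtain ⟨δ, c₂, hδ, hc₂, hCov⟩ := cov237_box_decay d ℓ hℓ (amin * (1 - ((((ℓ : ℝ) + 1)) ^ 2)⁻¹)) aplus
    m2plus amin aplus (aminus'_pos hℓ ha) ha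
  have hK0 : ∀ t : ℝ, 0 < t → 0 ≤ latticeConst (d + 1) t := fun t ht => latticeConst_nonneg _ ht.le
  have hκ₁ : 0 < min κ κ' := lt_min hκ hκ'
  have hKκ := hK0 _ (half_pos hκ₁)
  have hKδ := hK0 _ (half_pos hδ)
  refine ⟨min (min κ κ') δ / 2, 2 * (aplus ^ 2 * (C' * c₂ * C₁)
      * (latticeConst (d + 1) (min κ κ' / 2) * latticeConst (d + 1) (δ / 2)
          * latticeConst (d + 1) (min κ κ' / 2))),
    by positivity, ?_, ?_⟩
  · exact mul_nonneg (by norm_num) (mul_nonneg (mul_nonneg (sq_nonneg _)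
      (mul_nonneg (mul_nonneg hC' hc₂.le) hC₁)) (mul_nonneg (mul_nonneg hKκ hKδ) hKκ))
  intro δ₀ hδ0 hδ1 k j hj1 hj a m2 h1 h2 h3 h4 M hM μ x xe x' xe' hxe hxe' hne
  have ha0 : 0 < a := lt_of_lt_of_le ha h1
  obtain ⟨hw1, hw2, hapos⟩ := aSeq_window hℓ ha h1 h2 hj1
  have hs : 0 < sc ℓ k j ^ 2 := pow_pos (sc_pos ℓ k j) 2
  have hsi : 0 < (sc ℓ k j ^ 2)⁻¹ := inv_pos.2 hs
  have hs1i : 0 < (sc ℓ k j)⁻¹ := inv_pos.2 (sc_pos ℓ k j)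
  have hsα : 0 ≤ sc ℓ k j ^ α := Real.rpow_nonneg (sc_pos ℓ k j).le α
  have hP0 : 0 ≤ sc ℓ k j ^ α * (sc ℓ k j)⁻¹ * C' := mul_nonneg (mul_nonneg hsα hs1i.le) hC'
  have hsc0 : sc ℓ k j ≠ 0 := (sc_pos ℓ k j).ne'
  have hm' : 0 ≤ m2 / sc ℓ k j ^ 2 := div_nonneg h3 hs.le
  have hm'' : m2 / sc ℓ k j ^ 2 ≤ m2plus :=
    (div_le_self h3 (one_le_pow₀ (one_le_sc ℓ k j))).trans h4
  have hb1 : 1 ≤ bj ℓ j := bj_pos ℓ j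
  have hbD : (0 : ℝ) < ((bj ℓ j : ℕ) : ℝ) ^ (d + 1) := by positivity
  have hδκ : δ₀ ≤ min κ κ' / 2 := hδ1.trans (by linarith [min_le_left (min κ κ') δ])
  have hδδ : δ₀ ≤ δ / 2 := hδ1.trans (by linarith [min_le_right (min κ κ') δ])
  -- the Hölder weight of the pair
  set W : ℝ := ((((ℓ + 1) ^ k : ℕ) : ℝ) / supNorm (x'.1 - x.1)) ^ α with hW
  have hσ1 : 1 ≤ supNorm (x'.1 - x.1) := one_le_supNorm (sub_ne_zero.2 hne)
  have hW0 : 0 ≤ W := Real.rpow_nonneg (div_nonneg (Nat.cast_nonneg _) (le_trans zero_le_one hσ1)) α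
  -- the doubly differenced, weighted block-row vector `g_H`
  set gH : ↥(boxDom (Mj ℓ k M j)) → ℝ := fun y => W * ((((ℓ + 1) ^ k : ℕ) : ℝ) *
      ((Amat ℓ k M j a m2 xe' y - Amat ℓ k M j a m2 x' y)
        - (Amat ℓ k M j a m2 xe y - Amat ℓ k M j a m2 x y))) with hgH
  have hg : ∀ y : ↥(boxDom (Mj ℓ k M j)), |gH y|
      ≤ sc ℓ k j ^ α * (sc ℓ k j)⁻¹ * C' *
          Real.exp (-(min κ κ' *
            min (supNorm (blk (bj ℓ j) x.1 - y.1)) (supNorm (blk (bj ℓ j) x'.1 - y.1)))) := by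
    intro y
    have hAd : (Amat ℓ k M j a m2 xe' y - Amat ℓ k M j a m2 x' y)
        - (Amat ℓ k M j a m2 xe y - Amat ℓ k M j a m2 x y)
        = ∑ x'', (if blk (bj ℓ j) x''.1 = y.1 then
            (Gfine ℓ k M j a m2 xe' x'' - Gfine ℓ k M j a m2 x' x'')
              - (Gfine ℓ k M j a m2 xe x'' - Gfine ℓ k M j a m2 x x'') else 0) := by
      simp only [Amat, Matrix.mul_apply, QksM, Matrix.of_apply, mul_ite, mul_one, mul_zero]
      rw [← Finset.sum_sub_distrib, ← Finset.sum_sub_distrib, ← Finset.sum_sub_distrib]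
      refine Finset.sum_congr rfl fun x'' _ => ?_
      split_ifs <;> ring
    have habs : |gH y| = W * |(((ℓ + 1) ^ k : ℕ) : ℝ) * ∑ x'', (if blk (bj ℓ j) x''.1 = y.1 then
            (Gfine ℓ k M j a m2 xe' x'' - Gfine ℓ k M j a m2 x' x'')
              - (Gfine ℓ k M j a m2 xe x'' - Gfine ℓ k M j a m2 x x'') else 0)| := by
      rw [hgH]
      dsimp only
      rw [hAd, abs_mul, abs_of_nonneg hW0]
    rw [habs]
    exact (hHf k j hj1 hj a m2 h1 h2 h3 h4 M hM μ x xe x' xe' hxe hxe' hne y.1 y.2).trans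
      (mul_le_mul_of_nonneg_left (exp_rate_mono (min_le_right κ κ')
        (le_min (supNorm_nonneg _) (supNorm_nonneg _))) hP0)
  -- the split according to the nearer centre
  set g₁ : ↥(boxDom (Mj ℓ k M j)) → ℝ := fun y =>
    if supNorm (blk (bj ℓ j) x.1 - y.1) ≤ supNorm (blk (bj ℓ j) x'.1 - y.1) then gH y else 0 with hg₁
  set g₂ : ↥(boxDom (Mj ℓ k M j)) → ℝ := fun y =>
    if supNorm (blk (bj ℓ j) x.1 - y.1) ≤ supNorm (blk (bj ℓ j) x'.1 - y.1) then 0 else gH y with hg₂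
  have hg12 : ∀ y, gH y = g₁ y + g₂ y := by
    intro y
    simp only [hg₁, hg₂]
    split_ifs <;> simp
  have hg1 : ∀ y, |g₁ y| ≤ sc ℓ k j ^ α * (sc ℓ k j)⁻¹ * C' *
      Real.exp (-(min κ κ' * supNorm (blk (bj ℓ j) x.1 - y.1))) := by
    intro y
    simp only [hg₁]
    split_ifs with hle
    · refine (hg y).trans (le_of_eq ?_)
      rw [min_eq_left hle]
    · rw [abs_zero]
      positivity
  have hg2 : ∀ y, |g₂ y| ≤ sc ℓ k j ^ α * (sc ℓ k j)⁻¹ * C' *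
      Real.exp (-(min κ κ' * supNorm (blk (bj ℓ j) x'.1 - y.1))) := by
    intro y
    simp only [hg₂]
    split_ifs with hle
    · rw [abs_zero]
      positivity
    · refine (hg y).trans (le_of_eq ?_)
      rw [min_eq_right (le_of_lt (not_le.1 hle))]
  have hB : ∀ (y' : ↥(boxDom (Mj ℓ k M j))) (x'' : ↥(boxDom (Nf ℓ k M))),
      |Bmat ℓ k M j a m2 y' x''| ≤ ((((bj ℓ j : ℕ) : ℝ)) ^ (d + 1))⁻¹ *
        ((sc ℓ k j ^ 2)⁻¹ * C₁ * Real.exp (-(min κ κ' * supNorm (blk (bj ℓ j) x''.1 - y'.1)))) := by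
    intro y' x''
    have hBe : Bmat ℓ k M j a m2 y' x'' = ((((bj ℓ j : ℕ) : ℝ)) ^ (d + 1))⁻¹ *
        ∑ w, (if blk (bj ℓ j) w.1 = y'.1 then Gfine ℓ k M j a m2 x'' w else 0) := by
      simp only [Bmat, Matrix.mul_apply, QkM, Matrix.of_apply, Finset.mul_sum]
      refine Finset.sum_congr rfl fun w _ => ?_
      split_ifs with hw
      · rw [(Gfine_isSymm ℓ k M j a m2).apply x'' w]
      · rw [zero_mul, mul_zero]
    rw [hBe, abs_mul, abs_of_pos (inv_pos.2 hbD)]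
    refine mul_le_mul_of_nonneg_left ?_ (inv_pos.2 hbD).le
    exact (hR k j hj1 hj a m2 h1 h2 h3 h4 M hM x'' y'.1 y'.2).trans
      (mul_le_mul_of_nonneg_left (exp_rate_mono (min_le_left κ κ') (supNorm_nonneg _))
        (mul_nonneg hsi.le hC₁))
  have hC : ∀ (y y' : ↥(boxDom (Mj ℓ k M j))),
      |Cmat ℓ k M j a m2 y y'| ≤ (sc ℓ k j ^ 2)⁻¹ * c₂ * Real.exp (-(δ * supNorm (y.1 - y'.1))) := by
    intro y y'
    have h := (hCov (bj ℓ j) hb1 _ _ a hw1 hw2 hm' hm'' h1 h2 (Mp ℓ k M j) (Mp_pos hM)).2 y y'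
    rw [Cmat, Matrix.smul_apply, smul_eq_mul, abs_mul, abs_of_pos hsi, mul_assoc]
    exact mul_le_mul_of_nonneg_left h hsi.le
  -- the two triple-product estimates, about `x` and about `x′`
  have htri1 := wsum_gCB_le hj M x g₁ (Cmat ℓ k M j a m2) (Bmat ℓ k M j a m2)
    hP0 (mul_nonneg hsi.le hc₂.le) (mul_nonneg hsi.le hC₁) hκ₁ hδ hδ0 hδκ hδδ hg1 hC hB
  have htri2 := wsum_gCB_le hj M x' g₂ (Cmat ℓ k M j a m2) (Bmat ℓ k M j a m2)
    hP0 (mul_nonneg hsi.le hc₂.le) (mul_nonneg hsi.le hC₁) hκ₁ hδ hδ0 hδκ hδδ hg2 hC hB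
  -- the weighted doubly differenced row of `α_j²A_jC_jB_j`
  have hfun : (fun z => W * ((((ℓ + 1) ^ k : ℕ) : ℝ) *
        (((Gfine ℓ k M (j + 1) a m2 - Gfine ℓ k M j a m2) xe' z
            - (Gfine ℓ k M (j + 1) a m2 - Gfine ℓ k M j a m2) x' z)
          - ((Gfine ℓ k M (j + 1) a m2 - Gfine ℓ k M j a m2) xe z
            - (Gfine ℓ k M (j + 1) a m2 - Gfine ℓ k M j a m2) x z))))
      = fun z => αj a ℓ k j ^ 2 * ((∑ y', ∑ y, g₁ y * Cmat ℓ k M j a m2 y y' * Bmat ℓ k M j a m2 y' z)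
          + (∑ y', ∑ y, g₂ y * Cmat ℓ k M j a m2 y y' * Bmat ℓ k M j a m2 y' z)) := by
    funext z
    rw [Gfine_succ_sub hℓ hj1 hj hM ha0 h3, weight_smul_mul3_row_dd, ← Finset.sum_add_distrib]
    congr 1
    refine Finset.sum_congr rfl fun y' _ => ?_
    rw [← Finset.sum_add_distrib]
    refine Finset.sum_congr rfl fun y _ => ?_
    have h12 := hg12 y
    rw [hgH] at h12
    simp only at h12
    rw [h12]
    ring
  have hα : αj a ℓ k j ^ 2 ≤ aplus ^ 2 * (sc ℓ k j ^ 2) ^ 2 := by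
    unfold αj
    rw [mul_pow]
    exact mul_le_mul_of_nonneg_right (pow_le_pow_left₀ hapos.le hw2 2) (by positivity)
  rw [hfun, wsum2_mul_left _ _ _ _ (sq_nonneg _)]
  have hw2 := (wsum2_add_le δ₀ ((ℓ + 1) ^ k) x x'
      (fun z => ∑ y', ∑ y, g₁ y * Cmat ℓ k M j a m2 y y' * Bmat ℓ k M j a m2 y' z)
      (fun z => ∑ y', ∑ y, g₂ y * Cmat ℓ k M j a m2 y y' * Bmat ℓ k M j a m2 y' z)).trans
    (add_le_add (wsum2_le_wsum_left hδ0 _ x x' _) (wsum2_le_wsum_right hδ0 _ x x' _))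
  calc αj a ℓ k j ^ 2 * wsum2 δ₀ ((ℓ + 1) ^ k) x x'
        (fun z => (∑ y', ∑ y, g₁ y * Cmat ℓ k M j a m2 y y' * Bmat ℓ k M j a m2 y' z)
          + (∑ y', ∑ y, g₂ y * Cmat ℓ k M j a m2 y y' * Bmat ℓ k M j a m2 y' z))
      ≤ (aplus ^ 2 * (sc ℓ k j ^ 2) ^ 2) *
          (sc ℓ k j ^ α * (sc ℓ k j)⁻¹ * C' * ((sc ℓ k j ^ 2)⁻¹ * c₂) * ((sc ℓ k j ^ 2)⁻¹ * C₁)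
              * Real.exp δ₀ * (latticeConst (d + 1) (min κ κ' / 2) * latticeConst (d + 1) (δ / 2)
                  * latticeConst (d + 1) (min κ κ' / 2))
            + sc ℓ k j ^ α * (sc ℓ k j)⁻¹ * C' * ((sc ℓ k j ^ 2)⁻¹ * c₂) * ((sc ℓ k j ^ 2)⁻¹ * C₁)
              * Real.exp δ₀ * (latticeConst (d + 1) (min κ κ' / 2) * latticeConst (d + 1) (δ / 2)
                  * latticeConst (d + 1) (min κ κ' / 2))) :=
        mul_le_mul hα (hw2.trans (add_le_add htri1 htri2)) (wsum2_nonneg _ _ _ _ _) (by positivity)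
    _ = 2 * (aplus ^ 2 * (C' * c₂ * C₁)
          * (latticeConst (d + 1) (min κ κ' / 2) * latticeConst (d + 1) (δ / 2)
              * latticeConst (d + 1) (min κ κ' / 2)))
          * Real.exp δ₀ * (sc ℓ k j ^ α * (sc ℓ k j)⁻¹) := by
        field_simp
        ring

end StepBound

/-! ## §5 The induction over `j`: the geometric sum `Σ_j (L^jη)^{1−α}` of [B4] (2.39) -/

/-- `t^α ≤ t` for `t ≥ 1`, `α ≤ 1`. [folklore] -/
theorem rpow_le_self_of_one_le {t α : ℝ} (ht : 1 ≤ t) (hα : α ≤ 1) : t ^ α ≤ t := by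
  calc t ^ α ≤ t ^ (1 : ℝ) := Real.rpow_le_rpow_of_exponent_le ht hα
    _ = t := Real.rpow_one t

/-- `s_j^α s_j^{-1} = (L^αL^{-1})·s_{j+1}^α s_{j+1}^{-1}` — the ratio `L^{-(1−α)}` of the geometric series (2.39).
[folklore] -/
theorem sc_rpow_mul_inv_succ {ℓ k j : ℕ} (hj : j + 1 ≤ k) (α : ℝ) :
    sc ℓ k j ^ α * (sc ℓ k j)⁻¹
      = (((ℓ : ℝ) + 1) ^ α * (((ℓ : ℝ) + 1))⁻¹) * (sc ℓ k (j + 1) ^ α * (sc ℓ k (j + 1))⁻¹) := by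
  have hL0 : (0 : ℝ) ≤ (ℓ : ℝ) + 1 := by positivity
  rw [sc_eq_succ hj, Real.mul_rpow hL0 (sc_pos ℓ k (j + 1)).le, mul_inv]
  ring

/-- `s_j^α s_j^{-1} ≤ 1` (`s_j ≥ 1`, `α ≤ 1`). [folklore] -/
theorem sc_rpow_mul_inv_le_one (ℓ k j : ℕ) {α : ℝ} (hα : α ≤ 1) : sc ℓ k j ^ α * (sc ℓ k j)⁻¹ ≤ 1 := by
  have h := rpow_le_self_of_one_le (one_le_sc ℓ k j) hα
  calc sc ℓ k j ^ α * (sc ℓ k j)⁻¹ ≤ sc ℓ k j * (sc ℓ k j)⁻¹ :=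
      mul_le_mul_of_nonneg_right h (inv_pos.2 (sc_pos ℓ k j)).le
    _ = 1 := mul_inv_cancel₀ (sc_pos ℓ k j).ne'

/-- the ratio `L^αL^{-1} = L^{-(1−α)}` is `< 1` for `α < 1` — the place where `α < 1` is used. [folklore] -/
theorem Lratio_lt_one {ℓ : ℕ} (hℓ : 1 ≤ ℓ) {α : ℝ} (hα1 : α < 1) :
    ((ℓ : ℝ) + 1) ^ α * (((ℓ : ℝ) + 1))⁻¹ < 1 := by
  have hL := one_lt_L_real hℓ
  have hL0 : (0 : ℝ) < (ℓ : ℝ) + 1 := by positivity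
  have h : ((ℓ : ℝ) + 1) ^ α < (ℓ : ℝ) + 1 := by
    calc ((ℓ : ℝ) + 1) ^ α < ((ℓ : ℝ) + 1) ^ (1 : ℝ) := Real.rpow_lt_rpow_of_exponent_lt hL hα1
      _ = _ := Real.rpow_one _
  calc ((ℓ : ℝ) + 1) ^ α * (((ℓ : ℝ) + 1))⁻¹ < ((ℓ : ℝ) + 1) * (((ℓ : ℝ) + 1))⁻¹ :=
      mul_lt_mul_of_pos_right h (inv_pos.2 hL0)
    _ = 1 := mul_inv_cancel₀ hL0.ne'

/-- the Hölder weight is at most `L^k`: `(n/s)^α ≤ n` for `n ≥ 1`, `s ≥ 1`, `0 ≤ α ≤ 1`. [folklore] -/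
theorem holderWeight_le {n : ℕ} (hn : 1 ≤ n) {s α : ℝ} (hs : 1 ≤ s) (hα0 : 0 ≤ α) (hα1 : α ≤ 1) :
    ((n : ℝ) / s) ^ α ≤ (n : ℝ) := by
  have hn1 : (1 : ℝ) ≤ (n : ℝ) := by exact_mod_cast hn
  have hn0 : (0 : ℝ) ≤ (n : ℝ) := by positivity
  have hs0 : 0 < s := lt_of_lt_of_le one_pos hs
  calc ((n : ℝ) / s) ^ α ≤ (n : ℝ) ^ α :=
      Real.rpow_le_rpow (div_nonneg hn0 hs0.le) (div_le_self hn0 hs) hα0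
    _ ≤ (n : ℝ) := rpow_le_self_of_one_le hn1 hα1

/-- `(L^k)²·s_1^{-2} = L²` (`k ≥ 1`; `s_1 = L^{k-1}`): the base propagator `𝒢_1 = s_1^{-2}G_1(□)` loses exactly two
powers of `L` under the fine difference quotient `L^k·∇` and the Hölder weight `≤ L^k`. [folklore] -/
theorem Lk_sq_mul_sc_one_sq_inv {ℓ k : ℕ} (hk : 1 ≤ k) :
    (((ℓ + 1) ^ k : ℕ) : ℝ) * (((ℓ + 1) ^ k : ℕ) : ℝ) * (sc ℓ k 1 ^ 2)⁻¹ = ((ℓ : ℝ) + 1) ^ 2 := by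
  obtain ⟨k', rfl⟩ : ∃ k', k = k' + 1 := ⟨k - 1, by omega⟩
  have hsc : sc ℓ (k' + 1) 1 = ((ℓ : ℝ) + 1) ^ k' := by simp [sc]
  have hp : (0 : ℝ) < ((ℓ : ℝ) + 1) ^ k' := by positivity
  rw [hsc]
  push_cast
  field_simp
  ring

set_option maxHeartbeats 1600000 in
/-- **UNIFORM TWO-CENTRE WEIGHTED BOUND FOR THE HÖLDER-DIFFERENCED ROWS OF ALL THE PROPAGATORS `𝒢_j`,
`1 ≤ j ≤ k`**: for `0 ≤ α < 1` there are `δ₀ > 0`, `c₀ > 0` (depending on `d, ℓ, α` and the window only) with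
`Σ_z (L^k/|x′−x|_∞)^α·L^k·|(𝒢_j(x′+e_μ,z) − 𝒢_j(x′,z)) − (𝒢_j(x+e_μ,z) − 𝒢_j(x,z))|·e^{δ₀min(|x−z|,|x′−z|)/L^k} ≤ c₀`
for every box, every `k ≥ 1`, every `1 ≤ j ≤ k`, every axis `μ` and all `x ≠ x′` of the fine box (with `x+e_μ`,
`x′+e_μ` in the box) — induction over `j` from the base (the one-step box Green's function, doubly differenced
crudely: four entries, `(L^k/|x′−x|)^α ≤ L^k`, `(L^k)²s_1^{-2} = L²`) with the steps of §4, summed by the geometric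
series `Σ_{j<k}(L^{-(k-j)})^{1−α} ≤ L^{-(1−α)}/(1 − L^{-(1−α)})` of [B4] (2.39). [folklore] -/
theorem Gfine_rowwH_bound (d ℓ : ℕ) (hℓ : 1 ≤ ℓ) (amin aplus m2plus : ℝ) (ha : 0 < amin) {α : ℝ}
    (hα0 : 0 ≤ α) (hα1 : α < 1) :
    ∃ δ₀ c₀ : ℝ, 0 < δ₀ ∧ 0 < c₀ ∧ ∀ (k : ℕ), 1 ≤ k → ∀ (j : ℕ), 1 ≤ j → j ≤ k →
      ∀ (a m2 : ℝ), amin ≤ a → a ≤ aplus → 0 ≤ m2 → m2 ≤ m2plus → ∀ (M : Fin (d + 1) → ℕ),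
        (∀ i, 1 ≤ M i) → ∀ (μ : Fin (d + 1)) (x xe x' xe' : ↥(boxDom (Nf ℓ k M))),
          xe.1 = x.1 + Pi.single μ 1 → xe'.1 = x'.1 + Pi.single μ 1 → x'.1 ≠ x.1 →
          wsum2 δ₀ ((ℓ + 1) ^ k) x x' (fun z => ((((ℓ + 1) ^ k : ℕ) : ℝ) / supNorm (x'.1 - x.1)) ^ α *
              ((((ℓ + 1) ^ k : ℕ) : ℝ) * ((Gfine ℓ k M j a m2 xe' z - Gfine ℓ k M j a m2 x' z)
                - (Gfine ℓ k M j a m2 xe z - Gfine ℓ k M j a m2 x z)))) ≤ c₀ := by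
  obtain ⟨r, C₀, hr, hC₀, hdec⟩ := boxOpR_L_inv_decay d ℓ hℓ (amin * (1 - ((((ℓ : ℝ) + 1)) ^ 2)⁻¹))
    aplus m2plus (aminus'_pos hℓ ha)
  obtain ⟨κ₀, Θ, hκ₀, hΘ, hstep⟩ := step_termH_bound d ℓ hℓ amin aplus m2plus ha hα0 hα1
  set δ₀ : ℝ := min (r / 2) κ₀ with hδ₀
  have hδ0 : 0 < δ₀ := lt_min (half_pos hr) hκ₀
  have hδr : δ₀ ≤ r / 2 := min_le_left _ _
  have hδκ : δ₀ ≤ κ₀ := min_le_right _ _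
  have hK1 := one_le_latticeConst d (half_pos hr)
  have hL0 : (0 : ℝ) < (ℓ : ℝ) + 1 := by positivity
  set B₁ : ℝ := 2 * (((ℓ : ℝ) + 1) ^ 2 * C₀ * (Real.exp r + 1) * latticeConst (d + 1) (r / 2)) with hB₁
  have hB₁0 : 0 < B₁ := by positivity
  set q : ℝ := ((ℓ : ℝ) + 1) ^ α * (((ℓ : ℝ) + 1))⁻¹ with hq
  have hq0 : 0 < q := by positivity
  have hq1' : q < 1 := Lratio_lt_one hℓ hα1
  have hq1 : 0 < 1 - q := by linarith
  have hΘe : 0 ≤ Θ * Real.exp δ₀ := by positivity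
  refine ⟨δ₀, B₁ + Θ * Real.exp δ₀ * (q / (1 - q)), hδ0,
    by linarith [mul_nonneg hΘe (div_nonneg hq0.le hq1.le)], ?_⟩
  intro k hk j hj1 hjk a m2 h1 h2 h3 h4 M hM
  have ha0 : 0 < a := lt_of_lt_of_le ha h1
  have hnk : 1 ≤ (ℓ + 1) ^ k := Nat.one_le_pow _ _ (by omega)
  have hn0 : (0 : ℝ) ≤ (((ℓ + 1) ^ k : ℕ) : ℝ) := Nat.cast_nonneg _
  -- the base: entries of `𝒢_1`, scaled by `(L^k)²`
  obtain ⟨hw1, hw2, hapos⟩ := aSeq_window hℓ ha h1 h2 (le_refl 1)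
  have hT : ∀ p q' : ↥(boxDom (Nf ℓ k M)),
      (((ℓ + 1) ^ k : ℕ) : ℝ) * ((((ℓ + 1) ^ k : ℕ) : ℝ) * |Gfine ℓ k M 1 a m2 p q'|)
        ≤ ((ℓ : ℝ) + 1) ^ 2 * C₀ * Real.exp (-(r * supNorm (p.1 - q'.1))) := by
    intro p q'
    rcases Nat.lt_or_ge k 2 with hk2 | hk2
    · obtain rfl : k = 1 := by omega
      have hG : Gfine ℓ 1 M 1 a m2 = (boxOpR ((ℓ + 1) ^ 1) (B1.aSeq a ((ℓ : ℝ) + 1) 1) m2 M)⁻¹ := by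
        unfold Gfine
        rw [fineOp_top]
      rw [hG]
      have hd := hdec ((ℓ + 1) ^ 1) (pow_one _) _ _ hw1 hw2 h3 h4 M p q'
      have hc1 : (((ℓ + 1) ^ 1 : ℕ) : ℝ) = (ℓ : ℝ) + 1 := by push_cast; ring
      rw [hc1, ← mul_assoc, ← sq]
      exact (mul_le_mul_of_nonneg_left hd (by positivity)).trans (le_of_eq (by ring))
    · have hs : 0 < sc ℓ k 1 ^ 2 := pow_pos (sc_pos ℓ k 1) 2
      have hm' : 0 ≤ m2 / sc ℓ k 1 ^ 2 := div_nonneg h3 hs.le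
      have hm'' : m2 / sc ℓ k 1 ^ 2 ≤ m2plus :=
        (div_le_self h3 (one_le_pow₀ (one_le_sc ℓ k 1))).trans h4
      rw [Gfine_apply hℓ (le_refl 1) hk2 hM ha0 h3 p q', abs_mul, abs_of_pos (inv_pos.2 hs), ← mul_assoc,
        ← mul_assoc, Lk_sq_mul_sc_one_sq_inv hk]
      have hd := hdec (bj ℓ 1) (pow_one _) _ _ hw1 hw2 hm' hm'' (Mj ℓ k M 1)
        ((ej ℓ k M 1 hk2).symm p) ((ej ℓ k M 1 hk2).symm q')
      have hpv : ((ej ℓ k M 1 hk2).symm p).1 = p.1 := rfl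
      have hqv : ((ej ℓ k M 1 hk2).symm q').1 = q'.1 := rfl
      rw [hpv, hqv] at hd
      exact (mul_le_mul_of_nonneg_left hd (by positivity)).trans (le_of_eq (by ring))
  -- the base: singly differenced rows against a weight `w ≤ L^k`
  have hTD : ∀ (μ : Fin (d + 1)) (x xe : ↥(boxDom (Nf ℓ k M))), xe.1 = x.1 + Pi.single μ 1 →
      ∀ w : ℝ, 0 ≤ w → w ≤ (((ℓ + 1) ^ k : ℕ) : ℝ) →
      ∀ z : ↥(boxDom (Nf ℓ k M)),
        |w * ((((ℓ + 1) ^ k : ℕ) : ℝ) * (Gfine ℓ k M 1 a m2 xe z - Gfine ℓ k M 1 a m2 x z))|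
          ≤ ((ℓ : ℝ) + 1) ^ 2 * C₀ * (Real.exp r + 1) * Real.exp (-(r * supNorm (x.1 - z.1))) := by
    intro μ x xe hxe w hw0 hwn z
    have h1' := hT xe z
    have h2' := hT x z
    have hnb := supNorm_sub_le_nbr (x' := z.1) hxe
    have he : Real.exp (-(r * supNorm (xe.1 - z.1)))
        ≤ Real.exp r * Real.exp (-(r * supNorm (x.1 - z.1))) := by
      rw [← Real.exp_add]
      exact Real.exp_le_exp.2 (by nlinarith)
    have hLC : 0 ≤ ((ℓ : ℝ) + 1) ^ 2 * C₀ := by positivity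
    calc |w * ((((ℓ + 1) ^ k : ℕ) : ℝ) * (Gfine ℓ k M 1 a m2 xe z - Gfine ℓ k M 1 a m2 x z))|
        = w * ((((ℓ + 1) ^ k : ℕ) : ℝ) * |Gfine ℓ k M 1 a m2 xe z - Gfine ℓ k M 1 a m2 x z|) := by
          rw [abs_mul, abs_mul, abs_of_nonneg hw0, abs_of_nonneg hn0]
      _ ≤ (((ℓ + 1) ^ k : ℕ) : ℝ) * ((((ℓ + 1) ^ k : ℕ) : ℝ) *
            (|Gfine ℓ k M 1 a m2 xe z| + |Gfine ℓ k M 1 a m2 x z|)) :=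
          mul_le_mul hwn (mul_le_mul_of_nonneg_left (abs_sub _ _) hn0) (by positivity) hn0
      _ = (((ℓ + 1) ^ k : ℕ) : ℝ) * ((((ℓ + 1) ^ k : ℕ) : ℝ) * |Gfine ℓ k M 1 a m2 xe z|)
            + (((ℓ + 1) ^ k : ℕ) : ℝ) * ((((ℓ + 1) ^ k : ℕ) : ℝ) * |Gfine ℓ k M 1 a m2 x z|) := by ring
      _ ≤ ((ℓ : ℝ) + 1) ^ 2 * C₀ * Real.exp (-(r * supNorm (xe.1 - z.1)))
            + ((ℓ : ℝ) + 1) ^ 2 * C₀ * Real.exp (-(r * supNorm (x.1 - z.1))) := add_le_add h1' h2'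
      _ ≤ ((ℓ : ℝ) + 1) ^ 2 * C₀ * (Real.exp r * Real.exp (-(r * supNorm (x.1 - z.1))))
            + ((ℓ : ℝ) + 1) ^ 2 * C₀ * Real.exp (-(r * supNorm (x.1 - z.1))) :=
          add_le_add (mul_le_mul_of_nonneg_left he hLC) le_rfl
      _ = _ := by ring
  -- the inductive claim
  have main : ∀ j, 1 ≤ j → j ≤ k → ∀ (μ : Fin (d + 1)) (x xe x' xe' : ↥(boxDom (Nf ℓ k M))),
      xe.1 = x.1 + Pi.single μ 1 → xe'.1 = x'.1 + Pi.single μ 1 → x'.1 ≠ x.1 →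
      wsum2 δ₀ ((ℓ + 1) ^ k) x x' (fun z => ((((ℓ + 1) ^ k : ℕ) : ℝ) / supNorm (x'.1 - x.1)) ^ α *
          ((((ℓ + 1) ^ k : ℕ) : ℝ) * ((Gfine ℓ k M j a m2 xe' z - Gfine ℓ k M j a m2 x' z)
            - (Gfine ℓ k M j a m2 xe z - Gfine ℓ k M j a m2 x z))))
        ≤ B₁ + Θ * Real.exp δ₀ * (q * (sc ℓ k j ^ α * (sc ℓ k j)⁻¹) / (1 - q)) := by
    intro j hj1
    induction j, hj1 using Nat.le_induction with
    | base =>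
      intro _ μ x xe x' xe' hxe hxe' hne
      have hσ1 : 1 ≤ supNorm (x'.1 - x.1) := one_le_supNorm (sub_ne_zero.2 hne)
      have hW0 : 0 ≤ ((((ℓ + 1) ^ k : ℕ) : ℝ) / supNorm (x'.1 - x.1)) ^ α :=
        Real.rpow_nonneg (div_nonneg hn0 (le_trans zero_le_one hσ1)) α
      have hWn := holderWeight_le hnk hσ1 hα0 hα1.le
      have hB0 : 0 ≤ ((ℓ : ℝ) + 1) ^ 2 * C₀ * (Real.exp r + 1) := by positivity
      have hg₁ : ∀ z : ↥(boxDom (Nf ℓ k M)),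
          |-(((((ℓ + 1) ^ k : ℕ) : ℝ) / supNorm (x'.1 - x.1)) ^ α *
              ((((ℓ + 1) ^ k : ℕ) : ℝ) * (Gfine ℓ k M 1 a m2 xe z - Gfine ℓ k M 1 a m2 x z)))|
            ≤ ((ℓ : ℝ) + 1) ^ 2 * C₀ * (Real.exp r + 1) * Real.exp (-(r * supNorm (x.1 - z.1))) := by
        intro z
        rw [abs_neg]
        exact hTD μ x xe hxe _ hW0 hWn z
      have hg₂ : ∀ z : ↥(boxDom (Nf ℓ k M)),
          |((((ℓ + 1) ^ k : ℕ) : ℝ) / supNorm (x'.1 - x.1)) ^ α *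
              ((((ℓ + 1) ^ k : ℕ) : ℝ) * (Gfine ℓ k M 1 a m2 xe' z - Gfine ℓ k M 1 a m2 x' z))|
            ≤ ((ℓ : ℝ) + 1) ^ 2 * C₀ * (Real.exp r + 1) * Real.exp (-(r * supNorm (x'.1 - z.1))) :=
        fun z => hTD μ x' xe' hxe' _ hW0 hWn z
      have hsplit := wsum2_split_le hδ0.le ((ℓ + 1) ^ k) x x'
        (fun z => ((((ℓ + 1) ^ k : ℕ) : ℝ) / supNorm (x'.1 - x.1)) ^ α *
          ((((ℓ + 1) ^ k : ℕ) : ℝ) * ((Gfine ℓ k M 1 a m2 xe' z - Gfine ℓ k M 1 a m2 x' z)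
            - (Gfine ℓ k M 1 a m2 xe z - Gfine ℓ k M 1 a m2 x z))))
        (fun z => -(((((ℓ + 1) ^ k : ℕ) : ℝ) / supNorm (x'.1 - x.1)) ^ α *
          ((((ℓ + 1) ^ k : ℕ) : ℝ) * (Gfine ℓ k M 1 a m2 xe z - Gfine ℓ k M 1 a m2 x z))))
        (fun z => ((((ℓ + 1) ^ k : ℕ) : ℝ) / supNorm (x'.1 - x.1)) ^ α *
          ((((ℓ + 1) ^ k : ℕ) : ℝ) * (Gfine ℓ k M 1 a m2 xe' z - Gfine ℓ k M 1 a m2 x' z)))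
        (fun z => by ring)
      have hpos : 0 ≤ Θ * Real.exp δ₀ * (q * (sc ℓ k 1 ^ α * (sc ℓ k 1)⁻¹) / (1 - q)) :=
        mul_nonneg hΘe (div_nonneg (mul_nonneg hq0.le (mul_nonneg (Real.rpow_nonneg (sc_pos ℓ k 1).le α)
          (inv_pos.2 (sc_pos ℓ k 1)).le)) hq1.le)
      calc _ ≤ _ := hsplit
        _ ≤ ((ℓ : ℝ) + 1) ^ 2 * C₀ * (Real.exp r + 1) * latticeConst (d + 1) (r / 2)
              + ((ℓ : ℝ) + 1) ^ 2 * C₀ * (Real.exp r + 1) * latticeConst (d + 1) (r / 2) :=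
            add_le_add (wsum_le_of_decay hnk x hB0 hr hδ0.le hδr hg₁)
              (wsum_le_of_decay hnk x' hB0 hr hδ0.le hδr hg₂)
        _ = B₁ := by rw [hB₁]; ring
        _ ≤ B₁ + Θ * Real.exp δ₀ * (q * (sc ℓ k 1 ^ α * (sc ℓ k 1)⁻¹) / (1 - q)) := by linarith
    | succ j hj1 ih =>
      intro hjk μ x xe x' xe' hxe hxe' hne
      have hprev := ih (by omega) μ x xe x' xe' hxe hxe' hne
      have hst := hstep δ₀ hδ0.le hδκ k j hj1 hjk a m2 h1 h2 h3 h4 M hM μ x xe x' xe' hxe hxe' hne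
      have hsplit : (fun z => ((((ℓ + 1) ^ k : ℕ) : ℝ) / supNorm (x'.1 - x.1)) ^ α *
            ((((ℓ + 1) ^ k : ℕ) : ℝ) * ((Gfine ℓ k M (j + 1) a m2 xe' z - Gfine ℓ k M (j + 1) a m2 x' z)
              - (Gfine ℓ k M (j + 1) a m2 xe z - Gfine ℓ k M (j + 1) a m2 x z))))
          = fun z => ((((ℓ + 1) ^ k : ℕ) : ℝ) / supNorm (x'.1 - x.1)) ^ α *
              ((((ℓ + 1) ^ k : ℕ) : ℝ) *
                (((Gfine ℓ k M (j + 1) a m2 - Gfine ℓ k M j a m2) xe' z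
                    - (Gfine ℓ k M (j + 1) a m2 - Gfine ℓ k M j a m2) x' z)
                  - ((Gfine ℓ k M (j + 1) a m2 - Gfine ℓ k M j a m2) xe z
                    - (Gfine ℓ k M (j + 1) a m2 - Gfine ℓ k M j a m2) x z)))
            + ((((ℓ + 1) ^ k : ℕ) : ℝ) / supNorm (x'.1 - x.1)) ^ α *
              ((((ℓ + 1) ^ k : ℕ) : ℝ) * ((Gfine ℓ k M j a m2 xe' z - Gfine ℓ k M j a m2 x' z)
                - (Gfine ℓ k M j a m2 xe z - Gfine ℓ k M j a m2 x z))) := by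
        funext z
        simp only [Matrix.sub_apply]
        ring
      rw [hsplit]
      calc _ ≤ _ := wsum2_add_le _ _ _ _ _ _
        _ ≤ Θ * Real.exp δ₀ * (sc ℓ k j ^ α * (sc ℓ k j)⁻¹)
              + (B₁ + Θ * Real.exp δ₀ * (q * (sc ℓ k j ^ α * (sc ℓ k j)⁻¹) / (1 - q))) :=
            add_le_add hst hprev
        _ = B₁ + Θ * Real.exp δ₀ * (q * (sc ℓ k (j + 1) ^ α * (sc ℓ k (j + 1))⁻¹) / (1 - q)) := by
            rw [sc_rpow_mul_inv_succ hjk α, ← hq]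
            field_simp
            ring
  intro μ x xe x' xe' hxe hxe' hne
  have hm := main j hj1 hjk μ x xe x' xe' hxe hxe' hne
  have hs1 : sc ℓ k j ^ α * (sc ℓ k j)⁻¹ ≤ 1 := sc_rpow_mul_inv_le_one ℓ k j hα1.le
  have hgeo : q * (sc ℓ k j ^ α * (sc ℓ k j)⁻¹) / (1 - q) ≤ q / (1 - q) :=
    div_le_div_of_nonneg_right (mul_le_of_le_one_right hq0.le hs1) hq1.le
  have hfin := mul_le_mul_of_nonneg_left hgeo hΘe
  linarith

/-! ## §6 THEOREM (1.9) of [B4] at `A = 0` for boxes: the Hölder quotient of `∂^η_μG_k(□)`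
(two-centre weighted-row form) -/

/-- **[B4] p. 573 THEOREM (Proposition 2.1 of [1]), inequality (1.9) — the HÖLDER CLAUSE — at `A = 0`, for
RECTANGULAR PARALLELEPIPEDS `Ω = □`** (two-centre weighted-row form, slightly stronger than the pointwise statement):
for every `0 ≤ α < 1` there are `δ₀ > 0`, `c₀ > 0` depending only on `d`, `L = ℓ + 1`, `α` and the window such that
for every `k ≥ 1` (`η = L^{-k}`), every `(a, m²)` in the window, every box `□ = Π_μ[0, M_μ)` (`M_μ ≥ 1`), every axis `μ`
and all `x ≠ x′` in `□ ∩ ηℤ^{d+1}` with `xe = x + ηe_μ`, `xe′ = x′ + ηe_μ` in `□`: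
`Σ_{z ∈ □} (η|x′−x|_∞)^{-α}·|η^{-1}((G(xe′,z) − G(x′,z)) − (G(xe,z) − G(x,z)))|·e^{δ₀·min(dist(x,z), dist(x′,z))} ≤ c₀`,
`G = G_k(□) = (−Δ^{η,N}_□ + m² + a_kP_k)^{-1}` the propagator of (1.9) at `A = 0` in values form (`a ↤ a_k`, DICTIONARY),
`η^{-1}(φ(x + ηe_μ) − φ(x)) = (D^η_{0,μ}φ)(x) = (∂^η_μφ)(x)` ((1.3) at `A = 0`, `U ≡ 1`), `dist = |·|_∞/L^k`,
`min(dist(x,z), dist(x′,z)) = dist({x,x′}, z)`.  HONEST LABEL: proved by the print's box route (2.34)/(2.38)–(2.39) at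
`A = 0` over the package's kernel theorems ((2.36) = `B4Green242Bridge.greenBoxQ_holder_decay_236_inv`) — NOT a
transcription of the print's random-walk proof (2.13)/(2.18)–(2.22) of Proposition 2.1 for general `Ω`.
[cite: Balaban1983RegularityDecay, p. 573 Theorem (1.9); p. 582 (2.34), Lemma 2.4 (2.36), (2.38); p. 583 (2.39)] -/
theorem thm19_zero_box_holder_roww (d ℓ : ℕ) (hℓ : 1 ≤ ℓ) (amin aplus m2plus : ℝ) (ha : 0 < amin) (α : ℝ)
    (hα0 : 0 ≤ α) (hα1 : α < 1) :
    ∃ δ₀ c₀ : ℝ, 0 < δ₀ ∧ 0 < c₀ ∧ ∀ (k : ℕ), 1 ≤ k → ∀ (a m2 : ℝ), amin ≤ a → a ≤ aplus → 0 ≤ m2 →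
      m2 ≤ m2plus → ∀ (M : Fin (d + 1) → ℕ), (∀ i, 1 ≤ M i) →
        ∀ (μ : Fin (d + 1)) (x xe x' xe' : ↥(boxDom (fun i => (ℓ + 1) ^ k * M i))),
          xe.1 = x.1 + Pi.single μ 1 → xe'.1 = x'.1 + Pi.single μ 1 → x'.1 ≠ x.1 →
          ∑ z, |((((ℓ + 1) ^ k : ℕ) : ℝ) / supNorm (x'.1 - x.1)) ^ α * ((((ℓ + 1) ^ k : ℕ) : ℝ) *
                (((boxOpR ((ℓ + 1) ^ k) (B1.aSeq a ((ℓ : ℝ) + 1) k) m2 M)⁻¹ xe' z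
                    - (boxOpR ((ℓ + 1) ^ k) (B1.aSeq a ((ℓ : ℝ) + 1) k) m2 M)⁻¹ x' z)
                  - ((boxOpR ((ℓ + 1) ^ k) (B1.aSeq a ((ℓ : ℝ) + 1) k) m2 M)⁻¹ xe z
                    - (boxOpR ((ℓ + 1) ^ k) (B1.aSeq a ((ℓ : ℝ) + 1) k) m2 M)⁻¹ x z)))|
              * Real.exp (δ₀ * min (supNorm (x.1 - z.1)) (supNorm (x'.1 - z.1)) / (((ℓ + 1) ^ k : ℕ) : ℝ))
            ≤ c₀ := by
  obtain ⟨δ₀, c₀, hδ, hc, h⟩ := Gfine_rowwH_bound d ℓ hℓ amin aplus m2plus ha hα0 hα1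
  refine ⟨δ₀, c₀, hδ, hc, fun k hk a m2 h1 h2 h3 h4 M hM μ x xe x' xe' hxe hxe' hne => ?_⟩
  have hG : Gfine ℓ k M k a m2 = (boxOpR ((ℓ + 1) ^ k) (B1.aSeq a ((ℓ : ℝ) + 1) k) m2 M)⁻¹ := by
    unfold Gfine
    rw [fineOp_top]
  have := h k hk k hk le_rfl a m2 h1 h2 h3 h4 M hM μ x xe x' xe' hxe hxe' hne
  rw [wsum2, hG] at this
  exact this

/-! ## §7 The printed forms: (1.9) with `‖f‖_∞` and `dist({x,x′}, supp f)`, the Hölder part of Lemma 2.2 (2.16) at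
`A = 0`, the literal coefficient `a`, and the conjunction (1.9)–(1.10) at `A = 0` for boxes -/

section Corollaries

variable {N : Fin (d + 1) → ℕ}

/-- the weighted second difference of `Tf` is the vector of weighted doubly differenced kernel rows applied to `f`:
`w·(t·(((Tf)(xe′) − (Tf)(x′)) − ((Tf)(xe) − (Tf)(x)))) = Σ_z (w·(t·((T(xe′,z) − T(x′,z)) − (T(xe,z) − T(x,z)))))f(z)`.
[folklore] -/
theorem mulVec_dd (T : Matrix ↥(boxDom N) ↥(boxDom N) ℝ) (f : ↥(boxDom N) → ℝ) (x xe x' xe' : ↥(boxDom N))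
    (w t : ℝ) :
    w * (t * (((T *ᵥ f) xe' - (T *ᵥ f) x') - ((T *ᵥ f) xe - (T *ᵥ f) x)))
      = ∑ z, (w * (t * ((T xe' z - T x' z) - (T xe z - T x z)))) * f z := by
  simp only [Matrix.mulVec, dotProduct]
  rw [← Finset.sum_sub_distrib, ← Finset.sum_sub_distrib, ← Finset.sum_sub_distrib, Finset.mul_sum,
    Finset.mul_sum]
  refine Finset.sum_congr rfl fun z _ => ?_
  ring

/-- monotonicity of the printed bound `c·e^{−δD/n}·F` in the constants (`c ≤ c′`, `δ′ ≤ δ`, `D, n, F ≥ 0`). [folklore] -/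
theorem decayBound_mono {c c' δ δ' D n F : ℝ} (hc : c ≤ c') (hδ : δ' ≤ δ) (hc0 : 0 ≤ c) (hD : 0 ≤ D)
    (hn : 0 ≤ n) (hF : 0 ≤ F) :
    c * Real.exp (-(δ * D / n)) * F ≤ c' * Real.exp (-(δ' * D / n)) * F := by
  have he : Real.exp (-(δ * D / n)) ≤ Real.exp (-(δ' * D / n)) := by
    apply Real.exp_le_exp.2
    have := div_le_div_of_nonneg_right (mul_le_mul_of_nonneg_right hδ hD) hn
    linarith
  exact mul_le_mul_of_nonneg_right (mul_le_mul hc he (Real.exp_pos _).le (hc0.trans hc)) hF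

end Corollaries

/-- **THEOREM (1.9) OF [B4] AT `A = 0` FOR RECTANGULAR PARALLELEPIPEDS — THE PRINTED HÖLDER CLAUSE**
`|x − x′|^{−α}|(D^η_{0,μ}G_k(□)f)(x′) − (D^η_{0,μ}G_k(□)f)(x)| ≤ c₀ exp(−δ₀ dist({x,x′}, supp f))‖f‖_∞` for ALL
`x ≠ x′` in `□` with `x + ηe_μ, x′ + ηe_μ ∈ □` («for rectangular parallelepipeds, the inequalities hold without any
restrictions on the points x, x′», p. 573): for every `0 ≤ α < 1` there are `δ₀ > 0`, `c₀ > 0` depending only on `d`,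
`ℓ`, `α` and the window such that for every `k ≥ 1` (`η = L^{-k}`), `(a, m²)` in the window, every box, every
`f : □ ∩ ηℤ^{d+1} → ℝ`, every bound `F ≥ |f|`, every axis `μ`, all such `x, xe, x′, xe′` and every `D` with
`D ≤ min(|x − z|_∞, |x′ − z|_∞)` for all `z ∈ supp f` (fine-lattice units, `ηD ≤ dist_∞({x,x′}, supp f)`):
`(η|x′−x|_∞)^{-α}·|η^{-1}(((Gf)(xe′) − (Gf)(x′)) − ((Gf)(xe) − (Gf)(x)))| ≤ c₀·e^{−δ₀ηD}·F`.
[cite: Balaban1983RegularityDecay, Theorem (Prop. 2.1 of [1]) (1.9) p.573] -/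
theorem thm19_zero_box_holder_value (d ℓ : ℕ) (hℓ : 1 ≤ ℓ) (amin aplus m2plus : ℝ) (ha : 0 < amin) (α : ℝ)
    (hα0 : 0 ≤ α) (hα1 : α < 1) :
    ∃ δ₀ c₀ : ℝ, 0 < δ₀ ∧ 0 < c₀ ∧ ∀ (k : ℕ), 1 ≤ k → ∀ (a m2 : ℝ), amin ≤ a → a ≤ aplus → 0 ≤ m2 →
      m2 ≤ m2plus → ∀ (M : Fin (d + 1) → ℕ), (∀ i, 1 ≤ M i) →
      ∀ (f : ↥(boxDom (fun i => (ℓ + 1) ^ k * M i)) → ℝ) (F D : ℝ), (∀ z, |f z| ≤ F) →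
      ∀ (μ : Fin (d + 1)) (x xe x' xe' : ↥(boxDom (fun i => (ℓ + 1) ^ k * M i))),
        xe.1 = x.1 + Pi.single μ 1 → xe'.1 = x'.1 + Pi.single μ 1 → x'.1 ≠ x.1 →
        (∀ z, f z ≠ 0 → D ≤ min (supNorm (x.1 - z.1)) (supNorm (x'.1 - z.1))) →
        ((((ℓ + 1) ^ k : ℕ) : ℝ) / supNorm (x'.1 - x.1)) ^ α *
          |(((ℓ + 1) ^ k : ℕ) : ℝ) *
            ((((boxOpR ((ℓ + 1) ^ k) (B1.aSeq a ((ℓ : ℝ) + 1) k) m2 M)⁻¹ *ᵥ f) xe'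
                - ((boxOpR ((ℓ + 1) ^ k) (B1.aSeq a ((ℓ : ℝ) + 1) k) m2 M)⁻¹ *ᵥ f) x')
              - (((boxOpR ((ℓ + 1) ^ k) (B1.aSeq a ((ℓ : ℝ) + 1) k) m2 M)⁻¹ *ᵥ f) xe
                - ((boxOpR ((ℓ + 1) ^ k) (B1.aSeq a ((ℓ : ℝ) + 1) k) m2 M)⁻¹ *ᵥ f) x))|
          ≤ c₀ * Real.exp (-(δ₀ * D / (((ℓ + 1) ^ k : ℕ) : ℝ))) * F := by
  obtain ⟨δ₀, c₀, hδ0, hc0, h⟩ := thm19_zero_box_holder_roww d ℓ hℓ amin aplus m2plus ha α hα0 hα1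
  refine ⟨δ₀, c₀, hδ0, hc0, ?_⟩
  intro k hk a m2 h1 h2 h3 h4 M hM f F D hF μ x xe x' xe' hxe hxe' hne hD
  have hW0 : 0 ≤ ((((ℓ + 1) ^ k : ℕ) : ℝ) / supNorm (x'.1 - x.1)) ^ α :=
    Real.rpow_nonneg (div_nonneg (Nat.cast_nonneg _) (supNorm_nonneg _)) α
  rw [← abs_of_nonneg hW0, ← abs_mul, mulVec_dd]
  exact abs_sum_mul_le_of_wsum2 hδ0.le _ x x' _ (h k hk a m2 h1 h2 h3 h4 M hM μ x xe x' xe' hxe hxe' hne) f hF hD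

/-- **THE SAME WITH THE LITERAL `dist({x,x′}, supp f) = min(dist(x, supp f), dist(x′, supp f))`** (`dsupp f x` of
`B4Thm110ZeroBox` = the `ℓ^∞` distance from `x` to `supp f` in fine-lattice units):
`(η|x′−x|_∞)^{-α}|η^{-1}(((Gf)(xe′) − (Gf)(x′)) − ((Gf)(xe) − (Gf)(x)))| ≤ c₀e^{−δ₀η·min(dsupp f x, dsupp f x′)}·F`
for every `F ≥ |f|`. [cite: Balaban1983RegularityDecay, Theorem (Prop. 2.1 of [1]) (1.9) p.573] -/
theorem thm19_zero_box_holder_dist (d ℓ : ℕ) (hℓ : 1 ≤ ℓ) (amin aplus m2plus : ℝ) (ha : 0 < amin) (α : ℝ)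
    (hα0 : 0 ≤ α) (hα1 : α < 1) :
    ∃ δ₀ c₀ : ℝ, 0 < δ₀ ∧ 0 < c₀ ∧ ∀ (k : ℕ), 1 ≤ k → ∀ (a m2 : ℝ), amin ≤ a → a ≤ aplus → 0 ≤ m2 →
      m2 ≤ m2plus → ∀ (M : Fin (d + 1) → ℕ), (∀ i, 1 ≤ M i) →
      ∀ (f : ↥(boxDom (fun i => (ℓ + 1) ^ k * M i)) → ℝ) (F : ℝ), (∀ z, |f z| ≤ F) →
      ∀ (μ : Fin (d + 1)) (x xe x' xe' : ↥(boxDom (fun i => (ℓ + 1) ^ k * M i))),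
        xe.1 = x.1 + Pi.single μ 1 → xe'.1 = x'.1 + Pi.single μ 1 → x'.1 ≠ x.1 →
        ((((ℓ + 1) ^ k : ℕ) : ℝ) / supNorm (x'.1 - x.1)) ^ α *
          |(((ℓ + 1) ^ k : ℕ) : ℝ) *
            ((((boxOpR ((ℓ + 1) ^ k) (B1.aSeq a ((ℓ : ℝ) + 1) k) m2 M)⁻¹ *ᵥ f) xe'
                - ((boxOpR ((ℓ + 1) ^ k) (B1.aSeq a ((ℓ : ℝ) + 1) k) m2 M)⁻¹ *ᵥ f) x')
              - (((boxOpR ((ℓ + 1) ^ k) (B1.aSeq a ((ℓ : ℝ) + 1) k) m2 M)⁻¹ *ᵥ f) xe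
                - ((boxOpR ((ℓ + 1) ^ k) (B1.aSeq a ((ℓ : ℝ) + 1) k) m2 M)⁻¹ *ᵥ f) x))|
          ≤ c₀ * Real.exp (-(δ₀ * min (dsupp f x) (dsupp f x') / (((ℓ + 1) ^ k : ℕ) : ℝ))) * F := by
  obtain ⟨δ₀, c₀, hδ0, hc0, h⟩ := thm19_zero_box_holder_value d ℓ hℓ amin aplus m2plus ha α hα0 hα1
  refine ⟨δ₀, c₀, hδ0, hc0, ?_⟩
  intro k hk a m2 h1 h2 h3 h4 M hM f F hF μ x xe x' xe' hxe hxe' hne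
  exact h k hk a m2 h1 h2 h3 h4 M hM f F _ hF μ x xe x' xe' hxe hxe' hne
    fun z hz => min_le_min (dsupp_le f x z hz) (dsupp_le f x' z hz)

/-- **LEMMA 2.2 (2.16) AT `A = 0`, THE HÖLDER PART** (the third entry `sup_{x,x′,μ}|x′−x|^{−α}|…|` of the norm
`‖·‖_{1,α}` (2.14) applied to `G_k(□)f`; p. 583 (2.39) «≤ c′₁‖f‖_∞»):
`(η|x′−x|_∞)^{-α}|η^{-1}(((Gf)(xe′) − (Gf)(x′)) − ((Gf)(xe) − (Gf)(x)))| ≤ c₀‖f‖_∞` for all `x ≠ x′` with their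
`μ`-neighbours in `□`, uniformly in `k ≥ 1`, the window and the box (`D = 0` in the value bound).
[cite: Balaban1983RegularityDecay, (2.14) p.577, Lemma 2.2 (2.16) p.577; (2.39) p.583] -/
theorem lemma22_zero_box_holder_sup (d ℓ : ℕ) (hℓ : 1 ≤ ℓ) (amin aplus m2plus : ℝ) (ha : 0 < amin) (α : ℝ)
    (hα0 : 0 ≤ α) (hα1 : α < 1) :
    ∃ c₀ : ℝ, 0 < c₀ ∧ ∀ (k : ℕ), 1 ≤ k → ∀ (a m2 : ℝ), amin ≤ a → a ≤ aplus → 0 ≤ m2 →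
      m2 ≤ m2plus → ∀ (M : Fin (d + 1) → ℕ), (∀ i, 1 ≤ M i) →
      ∀ (f : ↥(boxDom (fun i => (ℓ + 1) ^ k * M i)) → ℝ) (F : ℝ), (∀ z, |f z| ≤ F) →
      ∀ (μ : Fin (d + 1)) (x xe x' xe' : ↥(boxDom (fun i => (ℓ + 1) ^ k * M i))),
        xe.1 = x.1 + Pi.single μ 1 → xe'.1 = x'.1 + Pi.single μ 1 → x'.1 ≠ x.1 →
        ((((ℓ + 1) ^ k : ℕ) : ℝ) / supNorm (x'.1 - x.1)) ^ α *
          |(((ℓ + 1) ^ k : ℕ) : ℝ) *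
            ((((boxOpR ((ℓ + 1) ^ k) (B1.aSeq a ((ℓ : ℝ) + 1) k) m2 M)⁻¹ *ᵥ f) xe'
                - ((boxOpR ((ℓ + 1) ^ k) (B1.aSeq a ((ℓ : ℝ) + 1) k) m2 M)⁻¹ *ᵥ f) x')
              - (((boxOpR ((ℓ + 1) ^ k) (B1.aSeq a ((ℓ : ℝ) + 1) k) m2 M)⁻¹ *ᵥ f) xe
                - ((boxOpR ((ℓ + 1) ^ k) (B1.aSeq a ((ℓ : ℝ) + 1) k) m2 M)⁻¹ *ᵥ f) x))| ≤ c₀ * F := by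
  obtain ⟨δ₀, c₀, hδ0, hc0, h⟩ := thm19_zero_box_holder_value d ℓ hℓ amin aplus m2plus ha α hα0 hα1
  refine ⟨c₀, hc0, ?_⟩
  intro k hk a m2 h1 h2 h3 h4 M hM f F hF μ x xe x' xe' hxe hxe' hne
  have := h k hk a m2 h1 h2 h3 h4 M hM f F 0 hF μ x xe x' xe' hxe hxe' hne
    fun z _ => le_min (supNorm_nonneg _) (supNorm_nonneg _)
  simpa using this

/-! ### The literal coefficient `a` of (1.6)

As in `B4Thm110ZeroBox` §11 / `B4Thm110ZeroBoxDeriv` §7: B4 (1.6) carries a generic `a` «close to 1» where the RG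
equations of [1] carry the running `a_k = B1.aSeq a L k = a·c_k`, `c_k ∈ [1 − L^{-2}, 1]`; since `a ↦ a_k` is a linear
bijection of `]0,∞[` the bounds hold for the literal coefficient over any window `[a₋, a₊]`, with the constants of the
window `[a₋, a₊/(1 − L^{-2})]`. -/

/-- **THE HÖLDER CLAUSE (1.9) AT `A = 0` FOR BOXES WITH THE LITERAL COEFFICIENT `a` OF (1.6)** (two-centre
weighted-row form). [cite: Balaban1983RegularityDecay, Theorem (Prop. 2.1 of [1]) (1.9) p.573 with (1.6) p.572] -/
theorem thm19_zero_box_holder_roww_coeff (d ℓ : ℕ) (hℓ : 1 ≤ ℓ) (amin aplus m2plus : ℝ) (ha : 0 < amin) (α : ℝ)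
    (hα0 : 0 ≤ α) (hα1 : α < 1) :
    ∃ δ₀ c₀ : ℝ, 0 < δ₀ ∧ 0 < c₀ ∧ ∀ (k : ℕ), 1 ≤ k → ∀ (a m2 : ℝ), amin ≤ a → a ≤ aplus → 0 ≤ m2 →
      m2 ≤ m2plus → ∀ (M : Fin (d + 1) → ℕ), (∀ i, 1 ≤ M i) →
        ∀ (μ : Fin (d + 1)) (x xe x' xe' : ↥(boxDom (fun i => (ℓ + 1) ^ k * M i))),
          xe.1 = x.1 + Pi.single μ 1 → xe'.1 = x'.1 + Pi.single μ 1 → x'.1 ≠ x.1 →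
          ∑ z, |((((ℓ + 1) ^ k : ℕ) : ℝ) / supNorm (x'.1 - x.1)) ^ α * ((((ℓ + 1) ^ k : ℕ) : ℝ) *
                (((boxOpR ((ℓ + 1) ^ k) a m2 M)⁻¹ xe' z - (boxOpR ((ℓ + 1) ^ k) a m2 M)⁻¹ x' z)
                  - ((boxOpR ((ℓ + 1) ^ k) a m2 M)⁻¹ xe z - (boxOpR ((ℓ + 1) ^ k) a m2 M)⁻¹ x z)))|
              * Real.exp (δ₀ * min (supNorm (x.1 - z.1)) (supNorm (x'.1 - z.1)) / (((ℓ + 1) ^ k : ℕ) : ℝ))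
            ≤ c₀ := by
  obtain ⟨δ₀, c₀, hδ0, hc0, h⟩ :=
    thm19_zero_box_holder_roww d ℓ hℓ amin (aplus / (1 - ((((ℓ : ℝ) + 1)) ^ 2)⁻¹)) m2plus ha α hα0 hα1
  refine ⟨δ₀, c₀, hδ0, hc0, ?_⟩
  intro k hk a m2 h1 h2 h3 h4 M hM μ x xe x' xe' hxe hxe' hne
  obtain ⟨hr0, hr1⟩ := Linv_sq_bounds hℓ
  have hc := cK_pos hℓ hk
  have hA1 : amin ≤ a / cK ℓ k := by
    rw [le_div_iff₀ hc]
    calc amin * cK ℓ k ≤ amin * 1 := mul_le_mul_of_nonneg_left (cK_le_one hℓ hk) ha.le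
      _ ≤ a := by linarith
  have hA2 : a / cK ℓ k ≤ aplus / (1 - ((((ℓ : ℝ) + 1)) ^ 2)⁻¹) :=
    div_le_div₀ (by linarith) h2 (by linarith) (oneSub_le_cK hℓ hk)
  have := h k hk (a / cK ℓ k) m2 hA1 hA2 h3 h4 M hM μ x xe x' xe' hxe hxe' hne
  rwa [aSeq_div_cK hℓ hk] at this

/-- … and the printed Hölder clause with the literal coefficient.
[cite: Balaban1983RegularityDecay, Theorem (Prop. 2.1 of [1]) (1.9) p.573 with (1.6) p.572] -/
theorem thm19_zero_box_holder_value_coeff (d ℓ : ℕ) (hℓ : 1 ≤ ℓ) (amin aplus m2plus : ℝ) (ha : 0 < amin) (α : ℝ)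
    (hα0 : 0 ≤ α) (hα1 : α < 1) :
    ∃ δ₀ c₀ : ℝ, 0 < δ₀ ∧ 0 < c₀ ∧ ∀ (k : ℕ), 1 ≤ k → ∀ (a m2 : ℝ), amin ≤ a → a ≤ aplus → 0 ≤ m2 →
      m2 ≤ m2plus → ∀ (M : Fin (d + 1) → ℕ), (∀ i, 1 ≤ M i) →
      ∀ (f : ↥(boxDom (fun i => (ℓ + 1) ^ k * M i)) → ℝ) (F D : ℝ), (∀ z, |f z| ≤ F) →
      ∀ (μ : Fin (d + 1)) (x xe x' xe' : ↥(boxDom (fun i => (ℓ + 1) ^ k * M i))),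
        xe.1 = x.1 + Pi.single μ 1 → xe'.1 = x'.1 + Pi.single μ 1 → x'.1 ≠ x.1 →
        (∀ z, f z ≠ 0 → D ≤ min (supNorm (x.1 - z.1)) (supNorm (x'.1 - z.1))) →
        ((((ℓ + 1) ^ k : ℕ) : ℝ) / supNorm (x'.1 - x.1)) ^ α *
          |(((ℓ + 1) ^ k : ℕ) : ℝ) *
            ((((boxOpR ((ℓ + 1) ^ k) a m2 M)⁻¹ *ᵥ f) xe' - ((boxOpR ((ℓ + 1) ^ k) a m2 M)⁻¹ *ᵥ f) x')
              - (((boxOpR ((ℓ + 1) ^ k) a m2 M)⁻¹ *ᵥ f) xe - ((boxOpR ((ℓ + 1) ^ k) a m2 M)⁻¹ *ᵥ f) x))|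
          ≤ c₀ * Real.exp (-(δ₀ * D / (((ℓ + 1) ^ k : ℕ) : ℝ))) * F := by
  obtain ⟨δ₀, c₀, hδ0, hc0, h⟩ := thm19_zero_box_holder_roww_coeff d ℓ hℓ amin aplus m2plus ha α hα0 hα1
  refine ⟨δ₀, c₀, hδ0, hc0, ?_⟩
  intro k hk a m2 h1 h2 h3 h4 M hM f F D hF μ x xe x' xe' hxe hxe' hne hD
  have hW0 : 0 ≤ ((((ℓ + 1) ^ k : ℕ) : ℝ) / supNorm (x'.1 - x.1)) ^ α :=
    Real.rpow_nonneg (div_nonneg (Nat.cast_nonneg _) (supNorm_nonneg _)) α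
  rw [← abs_of_nonneg hW0, ← abs_mul, mulVec_dd]
  exact abs_sum_mul_le_of_wsum2 hδ0.le _ x x' _ (h k hk a m2 h1 h2 h3 h4 M hM μ x xe x' xe' hxe hxe' hne) f hF hD

/-! ### (1.9)–(1.10) together at `A = 0` for boxes (`B4.Ineq19_110`, rectangular branch, `U ≡ 1`) -/

/-- **THE THEOREM OF [B4] p. 573, INEQUALITIES (1.9) AND (1.10), AT `A = 0` FOR RECTANGULAR PARALLELEPIPEDS, ALL
SCALES `k ≥ 1`, WITH COMMON CONSTANTS** — the conjunction of the Hölder clause (this file), the derivative clause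
(`B4Thm110ZeroBoxDeriv.thm110_zero_box_deriv_dist`) and the value clause (`B4Thm110ZeroBox.thm110_zero_box_dist`),
each with the literal `dist(·, supp f)` in fine-lattice `ℓ^∞` units: for every `0 ≤ α < 1` there are `δ₀ > 0`,
`c₀ > 0` (depending on `d`, `ℓ`, `α` and the window) such that for every `k ≥ 1`, `(a, m²)` in the window, every box,
every `f` and `F ≥ |f|`:
(1.9) `(η|x′−x|_∞)^{-α}|η^{-1}(((Gf)(xe′) − (Gf)(x′)) − ((Gf)(xe) − (Gf)(x)))| ≤ c₀e^{−δ₀η·min(dsupp f x, dsupp f x′)}F`;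
(1.10) `|η^{-1}((Gf)(xe) − (Gf)(x))| ≤ c₀e^{−δ₀η·dsupp f x}F` and `|(Gf)(x)| ≤ c₀e^{−δ₀η·dsupp f x}F` — for all points
(and `μ`-neighbours) of `□` («for rectangular parallelepipeds, the inequalities hold without any restrictions on the
points x, x′»). [cite: Balaban1983RegularityDecay, Theorem (Prop. 2.1 of [1]) (1.9)–(1.10) p.573] -/
theorem ineq19_110_zero_box (d ℓ : ℕ) (hℓ : 1 ≤ ℓ) (amin aplus m2plus : ℝ) (ha : 0 < amin) (α : ℝ)
    (hα0 : 0 ≤ α) (hα1 : α < 1) :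
    ∃ δ₀ c₀ : ℝ, 0 < δ₀ ∧ 0 < c₀ ∧ ∀ (k : ℕ), 1 ≤ k → ∀ (a m2 : ℝ), amin ≤ a → a ≤ aplus → 0 ≤ m2 →
      m2 ≤ m2plus → ∀ (M : Fin (d + 1) → ℕ), (∀ i, 1 ≤ M i) →
      ∀ (f : ↥(boxDom (fun i => (ℓ + 1) ^ k * M i)) → ℝ) (F : ℝ), (∀ z, |f z| ≤ F) →
        (∀ (μ : Fin (d + 1)) (x xe x' xe' : ↥(boxDom (fun i => (ℓ + 1) ^ k * M i))),
          xe.1 = x.1 + Pi.single μ 1 → xe'.1 = x'.1 + Pi.single μ 1 → x'.1 ≠ x.1 →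
          ((((ℓ + 1) ^ k : ℕ) : ℝ) / supNorm (x'.1 - x.1)) ^ α *
            |(((ℓ + 1) ^ k : ℕ) : ℝ) *
              ((((boxOpR ((ℓ + 1) ^ k) (B1.aSeq a ((ℓ : ℝ) + 1) k) m2 M)⁻¹ *ᵥ f) xe'
                  - ((boxOpR ((ℓ + 1) ^ k) (B1.aSeq a ((ℓ : ℝ) + 1) k) m2 M)⁻¹ *ᵥ f) x')
                - (((boxOpR ((ℓ + 1) ^ k) (B1.aSeq a ((ℓ : ℝ) + 1) k) m2 M)⁻¹ *ᵥ f) xe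
                  - ((boxOpR ((ℓ + 1) ^ k) (B1.aSeq a ((ℓ : ℝ) + 1) k) m2 M)⁻¹ *ᵥ f) x))|
            ≤ c₀ * Real.exp (-(δ₀ * min (dsupp f x) (dsupp f x') / (((ℓ + 1) ^ k : ℕ) : ℝ))) * F)
        ∧ (∀ (μ : Fin (d + 1)) (x xe : ↥(boxDom (fun i => (ℓ + 1) ^ k * M i))), xe.1 = x.1 + Pi.single μ 1 →
          |(((ℓ + 1) ^ k : ℕ) : ℝ) *
              (((boxOpR ((ℓ + 1) ^ k) (B1.aSeq a ((ℓ : ℝ) + 1) k) m2 M)⁻¹ *ᵥ f) xe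
                - ((boxOpR ((ℓ + 1) ^ k) (B1.aSeq a ((ℓ : ℝ) + 1) k) m2 M)⁻¹ *ᵥ f) x)|
            ≤ c₀ * Real.exp (-(δ₀ * dsupp f x / (((ℓ + 1) ^ k : ℕ) : ℝ))) * F)
        ∧ (∀ x : ↥(boxDom (fun i => (ℓ + 1) ^ k * M i)),
          |((boxOpR ((ℓ + 1) ^ k) (B1.aSeq a ((ℓ : ℝ) + 1) k) m2 M)⁻¹ *ᵥ f) x|
            ≤ c₀ * Real.exp (-(δ₀ * dsupp f x / (((ℓ + 1) ^ k : ℕ) : ℝ))) * F) := by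
  obtain ⟨δ₁, c₁, hδ1, hc1, hH⟩ := thm19_zero_box_holder_dist d ℓ hℓ amin aplus m2plus ha α hα0 hα1
  obtain ⟨δ₂, c₂, hδ2, hc2, hD⟩ := thm110_zero_box_deriv_dist d ℓ hℓ amin aplus m2plus ha
  obtain ⟨δ₃, c₃, hδ3, hc3, hV⟩ := thm110_zero_box_dist d ℓ hℓ amin aplus m2plus ha
  refine ⟨min δ₁ (min δ₂ δ₃), max c₁ (max c₂ c₃), lt_min hδ1 (lt_min hδ2 hδ3), lt_max_iff.2 (Or.inl hc1), ?_⟩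
  intro k hk a m2 h1 h2 h3 h4 M hM f F hF
  have hn : (0 : ℝ) ≤ (((ℓ + 1) ^ k : ℕ) : ℝ) := Nat.cast_nonneg _
  refine ⟨fun μ x xe x' xe' hxe hxe' hne => ?_, fun μ x xe hxe => ?_, fun x => ?_⟩
  · exact (hH k hk a m2 h1 h2 h3 h4 M hM f F hF μ x xe x' xe' hxe hxe' hne).trans
      (decayBound_mono (le_max_left _ _) (min_le_left _ _) hc1.le
        (le_min (dsupp_nonneg f x) (dsupp_nonneg f x')) hn ((abs_nonneg _).trans (hF x)))
  · exact (hD k hk a m2 h1 h2 h3 h4 M hM f F hF μ x xe hxe).trans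
      (decayBound_mono ((le_max_left _ _).trans (le_max_right _ _))
        ((min_le_right _ _).trans (min_le_left _ _)) hc2.le (dsupp_nonneg f x) hn ((abs_nonneg _).trans (hF x)))
  · exact (hV k hk a m2 h1 h2 h3 h4 M hM f F hF x).trans
      (decayBound_mono ((le_max_right _ _).trans (le_max_right _ _))
        ((min_le_right _ _).trans (min_le_right _ _)) hc3.le (dsupp_nonneg f x) hn ((abs_nonneg _).trans (hF x)))

/-! ## §8 Non-vacuity: the hypotheses are met (`d + 1 = 4`, `L = 2`, `α = 1/2`, window `a ∈ [1/2, 2]`,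
`m² ∈ [0, 1]`) -/

/-- the main theorem at the physical dimension `d + 1 = 4`, `L = 2`, Hölder exponent `α = 1/2`, literal coefficient. -/
example : ∃ δ₀ c₀ : ℝ, 0 < δ₀ ∧ 0 < c₀ ∧ ∀ (k : ℕ), 1 ≤ k → ∀ (a m2 : ℝ), (1 / 2 : ℝ) ≤ a → a ≤ 2 → 0 ≤ m2 →
      m2 ≤ 1 → ∀ (M : Fin (3 + 1) → ℕ), (∀ i, 1 ≤ M i) →
        ∀ (μ : Fin (3 + 1)) (x xe x' xe' : ↥(boxDom (fun i => (1 + 1) ^ k * M i))),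
          xe.1 = x.1 + Pi.single μ 1 → xe'.1 = x'.1 + Pi.single μ 1 → x'.1 ≠ x.1 →
          ∑ z, |((((1 + 1) ^ k : ℕ) : ℝ) / supNorm (x'.1 - x.1)) ^ (1 / 2 : ℝ) * ((((1 + 1) ^ k : ℕ) : ℝ) *
                (((boxOpR ((1 + 1) ^ k) a m2 M)⁻¹ xe' z - (boxOpR ((1 + 1) ^ k) a m2 M)⁻¹ x' z)
                  - ((boxOpR ((1 + 1) ^ k) a m2 M)⁻¹ xe z - (boxOpR ((1 + 1) ^ k) a m2 M)⁻¹ x z)))|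
              * Real.exp (δ₀ * min (supNorm (x.1 - z.1)) (supNorm (x'.1 - z.1)) / (((1 + 1) ^ k : ℕ) : ℝ))
            ≤ c₀ :=
  thm19_zero_box_holder_roww_coeff 3 1 le_rfl (1 / 2) 2 1 (by norm_num) (1 / 2) (by norm_num) (by norm_num)

/-- the quantifier prefix of the theorems is inhabited: `k = 1`, `a = 1`, `m² = 0`, `α = 1/2`, the unit cube
`M ≡ 1`, the axis `μ = 0`, and the points `x = 0`, `xe = e_0`, `x′ = e_1`, `xe′ = e_1 + e_0` of the fine box `{0,1}^4`
(`xe = x + e_0`, `xe′ = x′ + e_0`, `x′ ≠ x`). -/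
example : (1 : ℕ) ≤ 1 ∧ (1 / 2 : ℝ) ≤ 1 ∧ (1 : ℝ) ≤ 2 ∧ (0 : ℝ) ≤ 0 ∧ (0 : ℝ) ≤ 1 ∧ (0 : ℝ) ≤ 1 / 2
    ∧ (1 / 2 : ℝ) < 1
    ∧ (∀ i : Fin (3 + 1), 1 ≤ (fun _ => 1 : Fin (3 + 1) → ℕ) i)
    ∧ (fun _ => (0 : ℤ)) ∈ boxDom (fun i : Fin (3 + 1) => (1 + 1) ^ 1 * (fun _ => 1 : Fin (3 + 1) → ℕ) i)
    ∧ (Pi.single (0 : Fin (3 + 1)) (1 : ℤ))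
        ∈ boxDom (fun i : Fin (3 + 1) => (1 + 1) ^ 1 * (fun _ => 1 : Fin (3 + 1) → ℕ) i)
    ∧ (Pi.single (1 : Fin (3 + 1)) (1 : ℤ))
        ∈ boxDom (fun i : Fin (3 + 1) => (1 + 1) ^ 1 * (fun _ => 1 : Fin (3 + 1) → ℕ) i)
    ∧ (Pi.single (1 : Fin (3 + 1)) (1 : ℤ) + Pi.single (0 : Fin (3 + 1)) (1 : ℤ))
        ∈ boxDom (fun i : Fin (3 + 1) => (1 + 1) ^ 1 * (fun _ => 1 : Fin (3 + 1) → ℕ) i)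
    ∧ (Pi.single (0 : Fin (3 + 1)) (1 : ℤ) : Fin (3 + 1) → ℤ) = (fun _ => (0 : ℤ)) + Pi.single 0 1
    ∧ (Pi.single (1 : Fin (3 + 1)) (1 : ℤ) + Pi.single (0 : Fin (3 + 1)) (1 : ℤ) : Fin (3 + 1) → ℤ)
        = Pi.single (1 : Fin (3 + 1)) (1 : ℤ) + Pi.single 0 1
    ∧ (Pi.single (1 : Fin (3 + 1)) (1 : ℤ) : Fin (3 + 1) → ℤ) ≠ (fun _ => (0 : ℤ)) := by
  refine ⟨le_rfl, by norm_num, by norm_num, le_rfl, by norm_num, by norm_num, by norm_num, fun _ => le_rfl,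
    ?_, ?_, ?_, ?_, ?_, rfl, ?_⟩
  · exact mem_boxDom.2 fun _ => ⟨le_rfl, by norm_num⟩
  · refine mem_boxDom.2 fun i => ?_
    by_cases h : i = 0
    · subst h; simp
    · simp [h]
  · refine mem_boxDom.2 fun i => ?_
    by_cases h : i = 1
    · subst h; simp
    · simp [h]
  · refine mem_boxDom.2 fun i => ?_
    fin_cases i <;> simp
  · funext i
    simp
  · intro h
    have := congrFun h 1
    simp at this

end

end Literature.MathematicalPhysics.QuantumFieldTheory.Balaban1983to89.B4Thm19ZeroBoxHolder
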